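import Summits.AtomisticToContinuum.Crystallization.Theses.PalmUnimodularRigidity
import Summits.AtomisticToContinuum.Crystallization.Theorems.MinimiserShells.Negative.LoadBearing
import Summits.AtomisticToContinuum.Crystallization.Theorems.MinimiserShells.Negative.Rootedness
import Summits.AtomisticToContinuum.Crystallization.Theorems.PalmUnimodularRigidityMinimiserShellsEquilibriumInLaw
import Summits.AtomisticToContinuum.Crystallization.Theorems.PalmUnimodularRigidityMinimiserShellsEnergyFloor
import Summits.AtomisticToContinuum.Crystallization.Theorems.PalmUnimodularRigidityMinimiserShellsGoodShellMeasurable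
import Summits.AtomisticToContinuum.Crystallization.Theorems.PalmUnimodularRigidityMinimiserShellsPalmDensity
import Summits.AtomisticToContinuum.Crystallization.Theorems.PalmUnimodularRigidityMinimiserShellsPalmZeroDensity
import Summits.AtomisticToContinuum.Crystallization.Theorems.PalmUnimodularRigidityMinimiserShellsMuGSCBasics
import Summits.AtomisticToContinuum.Crystallization.Theorems.PalmUnimodularRigidityMinimiserShellsPricingTransfer
import Summits.AtomisticToContinuum.Crystallization.Theorems.PalmUnimodularRigidityMinimiserShellsDeepBadPricingOfShellNoBoundary
import Summits.AtomisticToContinuum.Crystallization.Theorems.PalmUnimodularRigidityMinimiserShellsShellNoBoundaryOfShellGapWith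
import Summits.AtomisticToContinuum.Crystallization.Theorems.PalmUnimodularRigidityMinimiserShellsSlackEventTransfer
import Summits.AtomisticToContinuum.Crystallization.Theorems.PalmUnimodularRigidityMinimiserShellsThresholdTransfer
import Summits.AtomisticToContinuum.Crystallization.Theorems.PalmUnimodularRigidityMinimiserShellsThresholdOfQualShellNoBoundary
import Summits.AtomisticToContinuum.Crystallization.Theorems.PalmUnimodularRigidityMinimiserShellsQualShellNoBoundaryOfQualShellGapWith
import Summits.AtomisticToContinuum.Crystallization.Theorems.PalmUnimodularRigidityMinimiserShellsQualShellNoBoundaryOfPeriodicShellGap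
import Summits.AtomisticToContinuum.Crystallization.Theorems.PalmUnimodularRigidityMinimiserShellsPeriodicShellGapOfQualShellNoBoundary
import Summits.AtomisticToContinuum.Crystallization.Theorems.PalmUnimodularRigidityMinimiserShellsSepQualShellNoBoundaryOfSepPeriodicShellGap
import Summits.AtomisticToContinuum.Crystallization.Theorems.PalmUnimodularRigidityMinimiserShellsSepReductionSeparated
import Summits.AtomisticToContinuum.Crystallization.Theorems.PalmUnimodularRigidityMinimiserShellsSepReductionBad
import Summits.AtomisticToContinuum.Crystallization.Theorems.PalmUnimodularRigidityMinimiserShellsSepReductionAssembly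
import Summits.AtomisticToContinuum.Crystallization.Theorems.PalmUnimodularRigidityMinimiserShellsNecessityLimit
import Summits.AtomisticToContinuum.Crystallization.Theorems.PalmUnimodularRigidityMinimiserShellsNecessityRobust
import Summits.AtomisticToContinuum.Crystallization.Theorems.PalmUnimodularRigidityMinimiserShellsNecessityBlocks
import Summits.AtomisticToContinuum.Crystallization.Theorems.PalmUnimodularRigidityMinimiserShellsNecessitySandwich
import Literature.Probability.Process.PointStationaryLaw
import Literature.Probability.Process.LocallyMatches
import Literature.MathematicalPhysics.StatisticalMechanics.RootEnergy
import Literature.MathematicalPhysics.StatisticalMechanics.MuGSC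

/-!
# Line `equilibrium-in-law-surgery` — lead's skeleton for crux `MinimiserShells` (stmt-AtomisticToContinuum-9225)

Route `route-AtomisticToContinuum-PalmUnimodularRigidity`; crux decl
`Summit.AtomisticToContinuum.Crystallization.Theses.PalmUnimodularRigidity.MinimiserShells`, concluded BY NAME by
`MinimiserShells_of''''` (hypotheses = the r5 stub statements, real proof) and by the closed term
`MinimiserShells_proof : MinimiserShells := MinimiserShells_of'''' stub_periodicShellGap stub_qualShellNoBoundary_of_periodicShellGap
  stub_thresholdBadPricing_of_qualShellNoBoundary stub_slackEventTransfer stub_thresholdTransfer`.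
Line card: `Cruxes/MinimiserShells/Lines/equilibrium-in-law-surgery.md`.

## RESHAPE r6 (continuation lead `…-c3-0`, 2026-08-16): HARD-CORE REDUCTION — the residual is the periodic shell gap for
`1/3`-separated periodic configurations (S7⁗ `stub_sepPeriodicShellGap`, OPEN), through S16 (periodisation keeps the hard
core), S15e (energy-minimal sub-configurations of near-minimisers are `1/3`-separated — S15b — and keep half of the bad shells —
S15d), S14.  `MinimiserShells_proof := MinimiserShells_of'''' stub_periodicShellGap …` with `stub_periodicShellGap` now DERIVED
from S7⁗.  See the r6 section below.

## RESHAPE r5 (continuation lead `…-c3-0`, 2026-08-16): the residual lives on the PERIODIC class, where `e*` is defined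

State inherited (r4, lead `…-c2-0`): crux CLOSED MODULO {S7″ `stub_thresholdBadPricing`} (threshold pricing of deep badly-shelled
sites on large cube windows of `δ`-separated e*-`μ`GSCs), with the finite sufficient forms S11 (qualitative no-boundary shell gap
⇒ S7″) and S12 landed, and S7″ recorded as necessary for the crux modulo Benjamini–Schramm compactness.

r5 observation: `e* = ⨅_{Q periodic} e(Q)` is an infimum over `PeriodicConfiguration 3`, and every finite configuration IS (after
periodisation with the cubic lattice of period `2Σ‖yᵢ‖ + 2`, `ChargedEnergyGap/Negative/Periodisation.periodise`) a periodic
configuration whose motif shells, read in the infinite point set, are the shells of `y` (images are `≥ 2 > 5/4` away; the shell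
predicate reads only `B̄(·, 5/4)`, `ShellNoBoundary.goodShell_count_restrict_image_sub_congr`) and whose energy per particle is
`≤ 𝓔_N(y)/N` (`V_LJ ≤ 0` beyond `2^{-1/6}`, `energyPerParticle_periodise_le`).  Conversely the `K³`-blocks of a periodic `Q`
(`ChargedEnergyGap/Negative/Blocks*`) are finite configurations with `𝓔 ≤ #F·K³·e(Q) + o(K³)` whose deep block points are badly
shelled in the block iff their motif point is badly shelled in `Q`.  Hence the qualitative finite no-boundary shell gap (S11's
hypothesis) is EQUIVALENT to a statement about periodic configurations only, and the canonical residual of the line is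

* S7‴ `stub_periodicShellGap` (OPEN — the crux's physics, lead's stub): `∀ t > 0 ∃ κ > 0 ∀ Q : PeriodicConfiguration 3`: if at
  least `t·#motif` motif sites `x` are badly shelled in `Q.points` (`¬ GoodShell (count|((· − x) '' Q.points))`) then
  `e* + κ ≤ e(Q)` — "minimising sequences of periodic Lennard-Jones configurations have bad-shell fraction `→ 0`": bulk energetic
  crystallization in periodic shell form, over tree vocabulary only (no `μ`GSC, no window, no depth, no law).
* S13 `stub_qualShellNoBoundary_of_periodicShellGap`: S7‴ ⇒ S11's hypothesis (periodisation of finite configurations).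
* S14 `stub_periodicShellGap_of_qualShellNoBoundary`: S11's hypothesis ⇒ S7‴ (blocks of periodic configurations).
Composition: S7‴ →(S13) qualitative no-boundary shell gap →(S11) S7″ →(S8b, S8a) crux; `periodicShellGap_iff_qualShellNoBoundary`
(S13 ∧ S14) certifies that r5's residual is not stronger than r4's finite sufficient form.  S7″ and S7′ survive as the sorry-free
conditionals `MinimiserShells_of'''` / `minimiserShells_of_deepBadPricing` (their statements as hypotheses, no `sorry`).

## (history) RESHAPE r4 (continuation lead `…-c2-0`, 2026-08-16): the transfer consumes a THRESHOLD (qualitative) pricing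

State inherited (r3, lead `…-c1-0`): crux CLOSED MODULO {S7′ `stub_deepBadPricing`}: a LINEAR price `c > 0` per
`R₀`-deep badly-shelled site in every finite window of every `δ`-separated e*-`μ`GSC (S8 `stub_pricingTransfer` :
S7′ → crux, S9, S10 landed; S1, S2, S5 landed by lead `…-0`).

r4 observation: the landed event-transfer machine (`…EventTransfer{Cell,}`) averages the ENERGY and the EVENT over the
SAME window (the atoms of the root's cell of the random grid `u + Lℤ³`), so linearity in the number of bad sites is not
what the law-level step consumes.  Run with a per-site SLACK `s ≥ 0` in the pricing (`#C·e* + c·#G ≤ ½ΣΣ_C V + s·#C`)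
it gives `P(E)·c·L³ ≤ (6·CT + 6·c·R₀)·L² + s·L³` for every mesh `L`, i.e. `P(E) ≤ s/c` (S8a `stub_slackEventTransfer`,
class- and event-general).  A THRESHOLD pricing — windows whose deep-bad FRACTION is `≥ t` have excess energy DENSITY
`≥ κ` — is an affine pricing with `c = κ`, `s = κ·t` (the free periodisation bound `#C·e* ≤ ½ΣΣ_C V`,
`card_mul_eStar_le_half_sum_sum`, covers the windows below threshold), hence `P(bad) ≤ t` for every `t > 0`, hence `0`
(S8b `stub_thresholdTransfer`).  So the open stub becomes the strictly weaker, CONSTANT-FREE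

* S7″ `stub_thresholdBadPricing` (OPEN — the crux's physics, lead's stub): `∀ δ > 0 ∀ t > 0 ∃ L₀ R₀ κ > 0`: for every
  `δ`-separated e*-`μ`GSC `S`, every LARGE CUBE window `C = S ∩ Q` (`Q = ∏_i [a_i, a_i + L)`, `L ≥ L₀`) and every `G ⊆ C`
  of sites badly shelled in `S` and `R₀`-deep in `C`, `t·#C ≤ #G → #C·(e* + κ) ≤ ½ ∑∑_C V_LJ`.  Only cube windows are
  ever priced by the cell machine (its cells ARE half-open cubes, `SlackEventTransferCell.cell_eq_box`) and only in the
  limit `L → ∞`, so this is exactly what the transfer consumes.  (S7′ ⇒ S7″ with `κ = c·t`, `L₀ = 1`: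
  `thresholdBadPricing_of_deepBadPricing`.)
* S8a `stub_slackEventTransfer` (LANDED p118037 cell level, p118322 law level): slack-priced events have probability `≤ s/c` under minimising point-stationary
  hard-core laws a.s. carried by the priced class (the r3 theorem is the case `s = 0`).
* S8b `stub_thresholdTransfer` (LANDED p118017): S8a → S7″ → `MinimiserShells` (S1 + S2 put a.e. configuration in the DLR class,
  S5 makes the bad-shell event measurable, threshold ⇒ affine pricing, `t ↓ 0`).
* S11 `stub_thresholdBadPricing_of_qualShellNoBoundary` (LANDED p118018): the QUALITATIVE particle-level no-boundary shell gap
  (`∀ t > 0 ∃ κ > 0 ∀ N y`, `t·N ≤ #bad(y) → N·(e* + κ) ≤ 𝓔_N(y)`) implies S7″ (locality of `GoodShell`, as S9).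
* S12 `stub_qualShellNoBoundary_of_qualShellGapWith` (LANDED p118019): the same with a `C₀·N^{2/3}` boundary allowance implies
  the no-boundary form (far copies, as S10; the threshold `t` is preserved exactly).
Hence `minimiserShells_of_qualShellGapWith`: the classical bulk statement "configurations with energy `≤ N(e* + κ_t) −
C₀N^{2/3}` have fewer than `t·N` badly-shelled sites" — equivalently `𝓔_N(y_N)/N → e* ⇒ #bad(y_N)/N → 0` — implies
the crux.  Conversely S7″ is, up to the Benjamini–Schramm compactness of uniformly rooted windows (Disproof §4:
`isPointStationaryLaw_unifRooted`, `meanRootEnergy_unifRooted`; item 9230), NECESSARY: a failing sequence of windows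
is a sequence of exactly point-stationary hard-core laws with `E[h] → e*` and `P(bad) ≥ t`.  No line on this crux can
own a strictly easier energy stub; S7″ is the canonical residual (qualitative bulk energetic crystallization, shell
form, on the DLR class) — the analogue of crux 14231 `ChargedEnergyGap` with the `(a/100)`-shell predicate.

Registered stubs after r4: cited & landed `stub_equilibriumInLaw` (S1), `stub_energyFloor` (S2), `stub_goodShellMeasurable`
(S5), `stub_pricingTransfer` (S8), `stub_deepBadPricing_of_shellNoBoundary` (S9), `stub_shellNoBoundary_of_shellGapWith`
(S10); r4: `stub_thresholdBadPricing` (S7″, OPEN — the only `sorry`), and LANDED & cited `stub_slackEventTransfer` (S8a),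
`stub_thresholdTransfer` (S8b), `stub_thresholdBadPricing_of_qualShellNoBoundary` (S11), `stub_qualShellNoBoundary_of_qualShellGapWith`
(S12).  `MinimiserShells_proof` is CLOSED MODULO {S7″}.

## (history) RESHAPE r3 (continuation lead `…-c1-0`, 2026-08-16): the transfer consumes a FINITE LINEAR PRICING directly

State inherited (r2, lead `…-0`): five stubs LANDED — S1 `stub_equilibriumInLaw` (p97236: minimising
point-stationary hard-core laws are a.s. Sütő e*-`μ`GSCs), S2 `stub_energyFloor` (= item 9229, p98844), S5
`stub_goodShellMeasurable` (p86537), S6 `stub_palmDensity` (p81591), S6′ `stub_palmZeroDensity` (p104615) — and the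
crux CLOSED MODULO the deterministic stub S3′ `stub_dlrBadZeroDensity` ("zero relative density of badly-shelled
atoms in every uniformly discrete e*-`μ`GSC about every atom"), judged crux-sized: it mixes the bulk frustration
physics with CAPILLARITY (thin DLR-stable objects must be excluded configuration by configuration).

r3 observation: the random-grid / Mecke cell-averaging machine that proved S1 (`…EquilibriumInLaw{CellAverage,
CellSums,Assembly}`) is a GENERAL law-level transfer: any measurable event whose DEEP sites are LINEARLY PRICED on
finite sub-windows of the a.s. configuration class is `P`-null under a minimising point-stationary law
(`EventTransfer.measure_event_eq_zero_of_deepPricing`, this lead, 0 sorry).  Energy and event are averaged with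
the SAME weights (the atoms of the root's cell), so no volume growth, no surface tension and no per-configuration
density statement is needed — the capillarity half of S3′ disappears.  What remains is the bulk half, as a
finite, kit-testable inequality on the DLR class:

* S7′ `stub_deepBadPricing` (OPEN — the crux's physics, lead's stub): `∀ δ > 0 ∃ R₀ c > 0`: for every
  `δ`-separated e*-`μ`GSC `S`, every finite `C ⊆ S` and every `G ⊆ C` of badly-shelled sites `y`
  (`¬ GoodShell (count|(S − y))`) that are `R₀`-deep in `C` (`S ∩ B̄(y,R₀) ⊆ C`):
  `#C · e* + c · #G ≤ ½ ∑∑_C V_LJ`.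
* S8 `stub_pricingTransfer` (LANDED p116795; helpers `…EventTransferCell` p115848, `…EventTransfer` p116677):
  S7′ → `MinimiserShells` (uses S1, S2, S5 and the event transfer).
* S9 `stub_deepBadPricing_of_shellNoBoundary` (LANDED p116426, wave 1): the particle-level NO-BOUNDARY shell gap
  `N e* + κ #bad(y) ≤ 𝓔_N(y)` for all finite configurations implies S7′ (locality of `GoodShell`: it reads
  only `B̄(y, 5/4)`; `R₀ = 2`, `c = κ`; holds for ALL separated `S`).
* S10 `stub_shellNoBoundary_of_shellGapWith` (LANDED p116643, wave 1): the shell gap WITH boundary allowance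
  `N e* + κ #bad − C N^{2/3} ≤ 𝓔_N` implies the no-boundary form (far translated copies, bad count `× M`,
  uniform in `N`).
Hence also `minimiserShells_of_shellGapWith : ShellGapWith → MinimiserShells` (sorry-free, kept below) — the exact
analogue, for the shell predicate, of crux `ChargedEnergyGap` (stmt-AtomisticToContinuum-14231) for the charge predicate.
r2's route survives as the sorry-free conditional `minimiserShells_of_badZeroDensity` (S3′ as a hypothesis); r3's as
`MinimiserShells_of''` (S7′ as a hypothesis) and, through `thresholdBadPricing_of_deepBadPricing`, as a special case of r4.
-/

noncomputable section

open MeasureTheory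
open scoped ENNReal BigOperators Classical

namespace Summit.AtomisticToContinuum.Crystallization.Cruxes.MinimiserShells.EquilibriumInLawSurgery

open Literature.Probability.Process (IsPointStationaryLaw IsRootedHardCore count_restrict_singleton_ne_zero_iff)
open Literature.MathematicalPhysics.StatisticalMechanics (lennardJones IsMuGSC UniformlyDiscrete interactionEnergy)
open Summit.AtomisticToContinuum.Crystallization.Theses.PalmUnimodularRigidity
  (MinimiserShells UnimodularEnergyLowerBound)
open Summit.AtomisticToContinuum.Crystallization.Theorems.MinimiserShells.Negative.LoadBearing
  (eStar meanRootEnergy GoodShell minimiserShells_iff)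
open Summit.AtomisticToContinuum.Crystallization.Theorems.PalmUnimodularRigidityMinimiserShells

/-! ## Registered stubs — the three CLOSED ones used by r3 (cited from `Theorems/`, no `sorry`) -/

/-- **stub_equilibriumInLaw** (S1, LANDED p97236): minimising point-stationary hard-core laws are a.s. carried by Sütő
`μ`GSCs of Lennard-Jones at `μ = e*`. -/
theorem stub_equilibriumInLaw :
    UnimodularEnergyLowerBound →
      ∀ δ : ℝ, 0 < δ → ∀ P : Measure (Measure (EuclideanSpace ℝ (Fin 3))), IsProbabilityMeasure P →
        (∀ᵐ μ ∂P, IsRootedHardCore δ μ) → IsPointStationaryLaw P → meanRootEnergy P ≤ eStar →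
        ∀ᵐ μ ∂P, ∃ S : Set (EuclideanSpace ℝ (Fin 3)),
          μ = (Measure.count : Measure (EuclideanSpace ℝ (Fin 3))).restrict S ∧ IsMuGSC lennardJones eStar S :=
  EquilibriumInLaw.stub_equilibriumInLaw

/-- **stub_energyFloor** (S2 = route item 9229, LANDED p98844): `e_uni ≥ e*`. -/
theorem stub_energyFloor : UnimodularEnergyLowerBound :=
  EnergyFloor.stub_energyFloor

/-- **stub_goodShellMeasurable** (S5, LANDED p86537): the shell event is Giry-measurable modulo the hard-core class. -/
theorem stub_goodShellMeasurable :
    ∃ B : Set (Measure (EuclideanSpace ℝ (Fin 3))), MeasurableSet B ∧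
      ∀ δ : ℝ, 0 < δ → ∀ μ : Measure (EuclideanSpace ℝ (Fin 3)), IsRootedHardCore δ μ → (μ ∈ B ↔ GoodShell μ) :=
  GoodShellMeasurable.stub_goodShellMeasurable

/-! ## Registered stubs — r3, all LANDED (cited from `Theorems/`, no `sorry`) -/

/-- **stub_pricingTransfer** (S8, LANDED p116795 as `…Theorems.PalmUnimodularRigidityMinimiserShells.PricingTransfer.stub_pricingTransfer`;
helpers `…EventTransferCell` p115848, `…EventTransfer` p116677): deep bad pricing on the DLR class implies the crux.
Mechanism: S1 (+ S2) put a.e. configuration in the e*-DLR class; S5 makes the bad-shell event a measurable `Bᶜ`;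
the event-transfer theorem (random grid `Lℤ³ + U`, Mecke cell averaging, depth penalties) gives
`P(Bᶜ) · c L³ ≤ (6 CT + 6 c R₀) L²` for every `L`, hence `P(Bᶜ) = 0`. -/
theorem stub_pricingTransfer :
    (∀ δ : ℝ, 0 < δ → ∃ R₀ c : ℝ, 0 < R₀ ∧ 0 < c ∧
      ∀ S : Set (EuclideanSpace ℝ (Fin 3)), (∀ x ∈ S, ∀ z ∈ S, x ≠ z → δ ≤ dist x z) →
        IsMuGSC lennardJones eStar S →
        ∀ C : Finset (EuclideanSpace ℝ (Fin 3)), (↑C : Set (EuclideanSpace ℝ (Fin 3))) ⊆ S →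
        ∀ G : Finset (EuclideanSpace ℝ (Fin 3)), G ⊆ C →
          (∀ y ∈ G, ¬ GoodShell ((Measure.count : Measure (EuclideanSpace ℝ (Fin 3))).restrict
              ((fun z => z - y) '' S)) ∧ S ∩ Metric.closedBall y R₀ ⊆ ↑C) →
          (C.card : ℝ) * eStar + c * G.card ≤ (∑ x ∈ C, ∑ z ∈ C, lennardJones (dist x z)) / 2) →
    MinimiserShells :=
  PricingTransfer.stub_pricingTransfer

/-- **stub_deepBadPricing_of_shellNoBoundary** (S9, LANDED p116426 as `…ShellNoBoundary.stub_deepBadPricing_of_shellNoBoundary`, wave-1 worker): the particle-level no-boundary shell gap implies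
deep bad pricing (for ALL separated `S`, a fortiori on the DLR class).  Content: `GoodShell (count|(S − y))` reads
only `S ∩ B̄(y, 5/4)`, so a site that is `R₀`-deep (`R₀ ≥ 5/4`) in a finite window `C` is badly shelled in `S` iff
it is badly shelled in the finite configuration `C`; enumerate `C` injectively and compare `½ ∑∑_C V` with `𝓔_N`. -/
theorem stub_deepBadPricing_of_shellNoBoundary :
    (∃ κ : ℝ, 0 < κ ∧ ∀ (N : ℕ) (y : Fin N → EuclideanSpace ℝ (Fin 3)), Function.Injective y →
      (N : ℝ) * eStar + κ * (Nat.card {i : Fin N // ¬ GoodShell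
          ((Measure.count : Measure (EuclideanSpace ℝ (Fin 3))).restrict ((fun z => z - y i) '' Set.range y))} : ℝ) ≤
        interactionEnergy lennardJones y) →
    ∀ δ : ℝ, 0 < δ → ∃ R₀ c : ℝ, 0 < R₀ ∧ 0 < c ∧
      ∀ S : Set (EuclideanSpace ℝ (Fin 3)), (∀ x ∈ S, ∀ z ∈ S, x ≠ z → δ ≤ dist x z) →
        IsMuGSC lennardJones eStar S →
        ∀ C : Finset (EuclideanSpace ℝ (Fin 3)), (↑C : Set (EuclideanSpace ℝ (Fin 3))) ⊆ S →
        ∀ G : Finset (EuclideanSpace ℝ (Fin 3)), G ⊆ C →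
          (∀ y ∈ G, ¬ GoodShell ((Measure.count : Measure (EuclideanSpace ℝ (Fin 3))).restrict
              ((fun z => z - y) '' S)) ∧ S ∩ Metric.closedBall y R₀ ⊆ ↑C) →
          (C.card : ℝ) * eStar + c * G.card ≤ (∑ x ∈ C, ∑ z ∈ C, lennardJones (dist x z)) / 2 :=
  ShellNoBoundary.stub_deepBadPricing_of_shellNoBoundary

/-- **stub_shellNoBoundary_of_shellGapWith** (S10, LANDED p116643 as `…ShellGapAmplification.stub_shellNoBoundary_of_shellGapWith`, wave-1 worker): the shell gap with boundary allowance
`C₀ N^{2/3}` implies the no-boundary shell gap (with a possibly smaller price).  Content: `M` far translated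
copies of `y` have energy `≤ M · 𝓔_N(y)` (the Lennard-Jones cross terms are attractive beyond distance `1`) and
exactly `M · #bad` badly-shelled sites (shells read only `B̄(·, 5/4)`); divide by `M → ∞`; `N ≤ 1` by `e* < 0`
(`VolumeGrowth.Basics.eStar_neg`).  Template: `Theorems/ChargedEnergyGap/Negative/{FarCopies,NoBoundaryReduction}`. -/
theorem stub_shellNoBoundary_of_shellGapWith :
    (∃ κ C₀ : ℝ, 0 < κ ∧ ∀ (N : ℕ) (y : Fin N → EuclideanSpace ℝ (Fin 3)), Function.Injective y →
      (N : ℝ) * eStar + κ * (Nat.card {i : Fin N // ¬ GoodShell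
          ((Measure.count : Measure (EuclideanSpace ℝ (Fin 3))).restrict ((fun z => z - y i) '' Set.range y))} : ℝ) -
        C₀ * (N : ℝ) ^ (2 / 3 : ℝ) ≤ interactionEnergy lennardJones y) →
    ∃ κ : ℝ, 0 < κ ∧ ∀ (N : ℕ) (y : Fin N → EuclideanSpace ℝ (Fin 3)), Function.Injective y →
      (N : ℝ) * eStar + κ * (Nat.card {i : Fin N // ¬ GoodShell
          ((Measure.count : Measure (EuclideanSpace ℝ (Fin 3))).restrict ((fun z => z - y i) '' Set.range y))} : ℝ) ≤
        interactionEnergy lennardJones y :=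
  ShellGapAmplification.stub_shellNoBoundary_of_shellGapWith

/-! ## Registered stubs — r4, all LANDED (S8a, S8b, S11, S12 cited from `Theorems/`; r4's open stub S7″
`stub_thresholdBadPricing` is, from r5 on, the HYPOTHESIS `hPrice` of the sorry-free conditional `MinimiserShells_of'''` and the
CONCLUSION of `thresholdBadPricing_of_periodicShellGap`) -/

/-- **stub_slackEventTransfer** (S8a, LANDED p118322 as `…Theorems.PalmUnimodularRigidityMinimiserShells.SlackEventTransfer.stub_slackEventTransfer`;
cell level p118037 `…SlackEventTransferCell`; class- and event-general law-level transfer WITH SLACK).  Let `δ > 0` and let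
`P` be a point-stationary probability law on rooted `δ`-hard-core configurations, minimising (`E_P[h] ≤ e*`) and a.s.
carried by configurations `count|S` with `K S`.  Let `Ev` be a measurable set of configurations and suppose the deep
pricing inequality WITH SLACK `s ≥ 0` on large cube windows: for every `δ`-separated `S` with `K S`, every window
`C = S ∩ Q` (`Q` a half-open cube of side `L ≥ L₀`) and every `G ⊆ C` of sites at which `Ev` holds after re-rooting
and which are `R₀`-deep in `C`, `#C·e* + c·#G ≤ ½ ∑∑_C V_LJ + s·#C`.  Then `P Ev ≤ s / c`.
Proof route: the cell machine of `…EventTransferCell.pointwise_cell_inequality` / `…EventTransfer.measure_event_mul_le`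
run with the extra summand `s·#C` (it becomes `+ ofReal s` after dividing by the window size and `+ ofReal(s)·vol(cube L)`
after the phase integral): `P(Ev)·c·L³ ≤ (6·CT δ + 6·c·R₀)·L² + s·L³` for every `L > 0`; let `L → ∞`.  The r3 theorem
`measure_event_eq_zero_of_deepPricing` is the case `s = 0`. -/
theorem stub_slackEventTransfer :
    ∀ δ : ℝ, 0 < δ → ∀ P : Measure (Measure (EuclideanSpace ℝ (Fin 3))), IsProbabilityMeasure P →
      (∀ᵐ μ ∂P, IsRootedHardCore δ μ) → IsPointStationaryLaw P → meanRootEnergy P ≤ eStar →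
      ∀ K : Set (EuclideanSpace ℝ (Fin 3)) → Prop,
      (∀ᵐ μ ∂P, ∃ S : Set (EuclideanSpace ℝ (Fin 3)),
        μ = (Measure.count : Measure (EuclideanSpace ℝ (Fin 3))).restrict S ∧ K S) →
      ∀ Ev : Set (Measure (EuclideanSpace ℝ (Fin 3))), MeasurableSet Ev →
      ∀ L₀ R₀ c s : ℝ, 0 < L₀ → 0 < R₀ → 0 < c → 0 ≤ s →
      (∀ S : Set (EuclideanSpace ℝ (Fin 3)), (∀ x ∈ S, ∀ z ∈ S, x ≠ z → δ ≤ dist x z) → K S →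
        ∀ L : ℝ, L₀ ≤ L → ∀ a : Fin 3 → ℝ, ∀ C : Finset (EuclideanSpace ℝ (Fin 3)),
        (↑C : Set (EuclideanSpace ℝ (Fin 3))) = S ∩ {z : EuclideanSpace ℝ (Fin 3) | ∀ i, a i ≤ z i ∧ z i < a i + L} →
        ∀ G : Finset (EuclideanSpace ℝ (Fin 3)), G ⊆ C →
          (∀ y ∈ G, (Measure.count : Measure (EuclideanSpace ℝ (Fin 3))).restrict ((fun z => z - y) '' S) ∈ Ev ∧
            S ∩ Metric.closedBall y R₀ ⊆ ↑C) →
          (C.card : ℝ) * eStar + c * G.card ≤ (∑ x ∈ C, ∑ z ∈ C, lennardJones (dist x z)) / 2 + s * C.card) →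
      P Ev ≤ ENNReal.ofReal (s / c) :=
  SlackEventTransfer.stub_slackEventTransfer

/-- **stub_thresholdTransfer** (S8b, LANDED p118017 as `…Theorems.PalmUnimodularRigidityMinimiserShells.ThresholdTransfer.stub_thresholdTransfer`;
class-general form `ae_goodShell_of_thresholdBadPricing`).  The slack event transfer (S8a) turns the threshold pricing S7″ into the crux:
S1 (`EquilibriumInLaw.stub_equilibriumInLaw`, fed with S2 `EnergyFloor.stub_energyFloor`) puts a.e. configuration in the
e*-DLR class `K = IsMuGSC lennardJones eStar`; S5 (`GoodShellMeasurable.stub_goodShellMeasurable`) makes the bad-shell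
event a measurable `Bᶜ` (for re-rooted hard-core configurations `count|(S − y)`, `y ∈ S`, use `CellSums.sep_image_sub`
as in `PricingTransfer.ae_goodShell_of_deepBadPricing`); for `t > 0` the threshold pricing `(R₀, κ)` is an affine
pricing with `c = κ`, `s = κ·t` — below threshold use the free bound `#C·e* ≤ ½ΣΣ_C V`
(`EquilibriumInLaw.Cluster.card_mul_eStar_le_half_sum_sum`) and `#G ≤ #C`; so `P(Bᶜ) ≤ ofReal t` for every
`t > 0`, hence `P(Bᶜ) = 0` and the root shell is a.s. good. -/
theorem stub_thresholdTransfer :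
    (∀ δ : ℝ, 0 < δ → ∀ P : Measure (Measure (EuclideanSpace ℝ (Fin 3))), IsProbabilityMeasure P →
      (∀ᵐ μ ∂P, IsRootedHardCore δ μ) → IsPointStationaryLaw P → meanRootEnergy P ≤ eStar →
      ∀ K : Set (EuclideanSpace ℝ (Fin 3)) → Prop,
      (∀ᵐ μ ∂P, ∃ S : Set (EuclideanSpace ℝ (Fin 3)),
        μ = (Measure.count : Measure (EuclideanSpace ℝ (Fin 3))).restrict S ∧ K S) →
      ∀ Ev : Set (Measure (EuclideanSpace ℝ (Fin 3))), MeasurableSet Ev →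
      ∀ L₀ R₀ c s : ℝ, 0 < L₀ → 0 < R₀ → 0 < c → 0 ≤ s →
      (∀ S : Set (EuclideanSpace ℝ (Fin 3)), (∀ x ∈ S, ∀ z ∈ S, x ≠ z → δ ≤ dist x z) → K S →
        ∀ L : ℝ, L₀ ≤ L → ∀ a : Fin 3 → ℝ, ∀ C : Finset (EuclideanSpace ℝ (Fin 3)),
        (↑C : Set (EuclideanSpace ℝ (Fin 3))) = S ∩ {z : EuclideanSpace ℝ (Fin 3) | ∀ i, a i ≤ z i ∧ z i < a i + L} →
        ∀ G : Finset (EuclideanSpace ℝ (Fin 3)), G ⊆ C →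
          (∀ y ∈ G, (Measure.count : Measure (EuclideanSpace ℝ (Fin 3))).restrict ((fun z => z - y) '' S) ∈ Ev ∧
            S ∩ Metric.closedBall y R₀ ⊆ ↑C) →
          (C.card : ℝ) * eStar + c * G.card ≤ (∑ x ∈ C, ∑ z ∈ C, lennardJones (dist x z)) / 2 + s * C.card) →
      P Ev ≤ ENNReal.ofReal (s / c)) →
    (∀ δ : ℝ, 0 < δ → ∀ t : ℝ, 0 < t → ∃ L₀ R₀ κ : ℝ, 0 < L₀ ∧ 0 < R₀ ∧ 0 < κ ∧
      ∀ S : Set (EuclideanSpace ℝ (Fin 3)), (∀ x ∈ S, ∀ z ∈ S, x ≠ z → δ ≤ dist x z) →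
        IsMuGSC lennardJones eStar S →
        ∀ L : ℝ, L₀ ≤ L → ∀ a : Fin 3 → ℝ, ∀ C : Finset (EuclideanSpace ℝ (Fin 3)),
          (↑C : Set (EuclideanSpace ℝ (Fin 3))) =
            S ∩ {z : EuclideanSpace ℝ (Fin 3) | ∀ i, a i ≤ z i ∧ z i < a i + L} →
        ∀ G : Finset (EuclideanSpace ℝ (Fin 3)), G ⊆ C →
          (∀ y ∈ G, ¬ GoodShell ((Measure.count : Measure (EuclideanSpace ℝ (Fin 3))).restrict
              ((fun z => z - y) '' S)) ∧ S ∩ Metric.closedBall y R₀ ⊆ ↑C) →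
          t * (C.card : ℝ) ≤ (G.card : ℝ) →
          (C.card : ℝ) * (eStar + κ) ≤ (∑ x ∈ C, ∑ z ∈ C, lennardJones (dist x z)) / 2) →
    MinimiserShells :=
  ThresholdTransfer.stub_thresholdTransfer

/-- **stub_thresholdBadPricing_of_qualShellNoBoundary** (S11, LANDED p118018 as
`…Theorems.PalmUnimodularRigidityMinimiserShells.QualShellNoBoundary.stub_thresholdBadPricing_of_qualShellNoBoundary`).  The QUALITATIVE particle-level no-boundary shell gap —
for every `t > 0` some `κ > 0` with `N·(e* + κ) ≤ 𝓔_N(y)` for every finite injective `y : Fin N → ℝ³` having at least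
`t·N` badly-shelled sites — implies the threshold pricing S7″, with `R₀ = 2` and the same `κ`, for every `S ⊆ ℝ³`
(separation and `μ`GSC unused).  Proof as S9 (`…DeepBadPricingOfShellNoBoundary`): enumerate `C` canonically
(`two_mul_interactionEnergy_equivFin`), inject the deep bad sites into the badly-shelled indices
(`ShellNoBoundary.card_le_natCard_bad`, locality of `GoodShell`), so `#bad(enumeration) ≥ #G ≥ t·#C`. -/
theorem stub_thresholdBadPricing_of_qualShellNoBoundary :
    (∀ t : ℝ, 0 < t → ∃ κ : ℝ, 0 < κ ∧ ∀ (N : ℕ) (y : Fin N → EuclideanSpace ℝ (Fin 3)), Function.Injective y →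
      t * (N : ℝ) ≤ (Nat.card {i : Fin N // ¬ GoodShell
          ((Measure.count : Measure (EuclideanSpace ℝ (Fin 3))).restrict ((fun z => z - y i) '' Set.range y))} : ℝ) →
      (N : ℝ) * (eStar + κ) ≤ interactionEnergy lennardJones y) →
    ∀ δ : ℝ, 0 < δ → ∀ t : ℝ, 0 < t → ∃ L₀ R₀ κ : ℝ, 0 < L₀ ∧ 0 < R₀ ∧ 0 < κ ∧
      ∀ S : Set (EuclideanSpace ℝ (Fin 3)), (∀ x ∈ S, ∀ z ∈ S, x ≠ z → δ ≤ dist x z) →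
        IsMuGSC lennardJones eStar S →
        ∀ L : ℝ, L₀ ≤ L → ∀ a : Fin 3 → ℝ, ∀ C : Finset (EuclideanSpace ℝ (Fin 3)),
          (↑C : Set (EuclideanSpace ℝ (Fin 3))) =
            S ∩ {z : EuclideanSpace ℝ (Fin 3) | ∀ i, a i ≤ z i ∧ z i < a i + L} →
        ∀ G : Finset (EuclideanSpace ℝ (Fin 3)), G ⊆ C →
          (∀ y ∈ G, ¬ GoodShell ((Measure.count : Measure (EuclideanSpace ℝ (Fin 3))).restrict
              ((fun z => z - y) '' S)) ∧ S ∩ Metric.closedBall y R₀ ⊆ ↑C) →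
          t * (C.card : ℝ) ≤ (G.card : ℝ) →
          (C.card : ℝ) * (eStar + κ) ≤ (∑ x ∈ C, ∑ z ∈ C, lennardJones (dist x z)) / 2 :=
  QualShellNoBoundary.stub_thresholdBadPricing_of_qualShellNoBoundary

/-- **stub_qualShellNoBoundary_of_qualShellGapWith** (S12, LANDED p118019 as
`…Theorems.PalmUnimodularRigidityMinimiserShells.QualShellGapAmplification.stub_qualShellNoBoundary_of_qualShellGapWith`).  The qualitative shell gap WITH boundary allowance
`C₀·N^{2/3}` implies the qualitative no-boundary shell gap, with the threshold `t` preserved exactly (and the same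
`κ`).  Proof as S10 (`…ShellNoBoundaryOfShellGapWith`, template `Theorems/ChargedEnergyGap/Negative/FarCopies`): `M`
far translated copies of `y` have energy `≤ M·𝓔_N(y)` and exactly `M·#bad(y)` badly-shelled sites
(`ShellGapAmplification.natCard_bad_copiesFin`), so `M·N·(e* + κ) − C₀·(M·N)^{2/3} ≤ M·𝓔_N(y)` for every `M ≥ 1`;
divide by `M` and let `M → ∞`. -/
theorem stub_qualShellNoBoundary_of_qualShellGapWith :
    (∀ t : ℝ, 0 < t → ∃ κ C₀ : ℝ, 0 < κ ∧ ∀ (N : ℕ) (y : Fin N → EuclideanSpace ℝ (Fin 3)), Function.Injective y →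
      t * (N : ℝ) ≤ (Nat.card {i : Fin N // ¬ GoodShell
          ((Measure.count : Measure (EuclideanSpace ℝ (Fin 3))).restrict ((fun z => z - y i) '' Set.range y))} : ℝ) →
      (N : ℝ) * (eStar + κ) - C₀ * (N : ℝ) ^ (2 / 3 : ℝ) ≤ interactionEnergy lennardJones y) →
    ∀ t : ℝ, 0 < t → ∃ κ : ℝ, 0 < κ ∧ ∀ (N : ℕ) (y : Fin N → EuclideanSpace ℝ (Fin 3)), Function.Injective y →
      t * (N : ℝ) ≤ (Nat.card {i : Fin N // ¬ GoodShell
          ((Measure.count : Measure (EuclideanSpace ℝ (Fin 3))).restrict ((fun z => z - y i) '' Set.range y))} : ℝ) →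
      (N : ℝ) * (eStar + κ) ≤ interactionEnergy lennardJones y :=
  QualShellGapAmplification.stub_qualShellNoBoundary_of_qualShellGapWith

/-! ## Registered stubs — r5 (S7‴ is the only `sorry` of the line; S13, S14 LANDED in wave 1 and are cited from `Theorems/`) -/

/-! ## Registered stubs — r6 (S7⁗ is the only `sorry` of the line; S16 p120587, S15b p120852, S15d p121132, S15e p121567 LANDED in wave 2, cited from `Theorems/`)

Reshape r6 (lead `…-c3-0`): the HARD-CORE REDUCTION.  A finite configuration `y` with energy below `N·(e* + κ)` contains an
energy-minimal sub-configuration `Z ⊆ range y` (minimal among ALL subsets for the half double sum `½ΣΣ V_LJ`); minimality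
against single removals makes every site sum of `Z` non-positive, hence (closest pair + shell sum `sum_inv_pow_six_le`, exactly
as in `LennardJonesMinimalDistance_holds`) `Z` is `1/3`-SEPARATED; minimality against `Z' = range y` and the periodisation
bound `#Z·e* ≤ ½ΣΣ_Z V` give `#removed·|e*| < N·κ`; and by locality of the shell predicate plus the packing bound
(`card_le_of_separated_of_dist_le`: at most `(17/2)³ < 615` points of `Z` within `5/4` of a removed point) the bad-shell count
drops by at most `616·#removed`.  So the finite no-boundary qualitative shell gap for `1/3`-separated configurations implies the
general one (S15e), and by periodisation (S16, as S13: the periodisation of a `1/3`-separated `y` has `1/3`-separated points) the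
residual becomes the periodic shell gap RESTRICTED TO `1/3`-HARD-CORE periodic configurations (S7⁗) — equivalent to S7‴ (and to
the finite forms), with the hard core of the tree's `LennardJonesMinimalDistance_holds` now a free hypothesis. -/

/-- **stub_sepPeriodicShellGap** (S7⁗, the OPEN CORE; the lead's stub).  The qualitative periodic shell gap for HARD-CORE
periodic configurations: for every `t > 0` there is `κ > 0` such that every periodic configuration `Q` of `ℝ³` whose point set
is `1/3`-separated and in which at least `t·#motif` motif sites are badly shelled in `Q.points` has `e* + κ ≤ e(Q)`.
Equivalent to S7‴ (`periodicShellGap_iff_sepPeriodicShellGap` below, through S16, S15e, S14); implies the crux; it is bulk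
energetic crystallization of 3-D Lennard-Jones in periodic shell form on the uniformly discrete class (the class on which
Benjamini–Schramm compactness holds, so that it is also necessary for the crux modulo that compactness).  OPEN. -/
theorem stub_sepPeriodicShellGap :
    ∀ t : ℝ, 0 < t → ∃ κ : ℝ, 0 < κ ∧
      ∀ Q : Literature.MathematicalPhysics.StatisticalMechanics.PeriodicConfiguration 3,
        (∀ p ∈ Q.points, ∀ q ∈ Q.points, p ≠ q → (1 : ℝ) / 3 ≤ dist p q) →
        t * (Q.motif.card : ℝ) ≤ (Nat.card {x : Q.motif // ¬ GoodShell
            ((Measure.count : Measure (EuclideanSpace ℝ (Fin 3))).restrict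
              ((fun z => z - (x : EuclideanSpace ℝ (Fin 3))) '' Q.points))} : ℝ) →
        eStar + κ ≤ Q.energyPerParticle lennardJones := by
  sorry

/-- **stub_sepQualShellNoBoundary_of_sepPeriodicShellGap** (S16, LANDED p120587 as `…Theorems.PalmUnimodularRigidityMinimiserShells.SepPeriodicShellGap.stub_sepQualShellNoBoundary_of_sepPeriodicShellGap`, wave-2 worker).  The hard-core periodic shell gap implies the finite
no-boundary qualitative shell gap for `1/3`-separated injective configurations (same `κ`).  Proof: as S13
(`PeriodicShellGap.stub_qualShellNoBoundary_of_periodicShellGap`: periodise `y` with the cubic lattice of period `2Σ‖yᵢ‖ + 2`,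
motif shells read in `Q.points` are the shells of `y`, `e(Q) ≤ 𝓔_N(y)/N`), plus: the periodisation of a `1/3`-separated `y`
has `1/3`-separated points (two points of `Q.points` are both some `yⱼ`, or differ by `yⱼ − y_k − ℓ` with `ℓ ≠ 0` a period,
hence are `≥ 2` apart by `two_le_dist_of_mem_points`). -/
theorem stub_sepQualShellNoBoundary_of_sepPeriodicShellGap :
    (∀ t : ℝ, 0 < t → ∃ κ : ℝ, 0 < κ ∧
      ∀ Q : Literature.MathematicalPhysics.StatisticalMechanics.PeriodicConfiguration 3,
        (∀ p ∈ Q.points, ∀ q ∈ Q.points, p ≠ q → (1 : ℝ) / 3 ≤ dist p q) →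
        t * (Q.motif.card : ℝ) ≤ (Nat.card {x : Q.motif // ¬ GoodShell
            ((Measure.count : Measure (EuclideanSpace ℝ (Fin 3))).restrict
              ((fun z => z - (x : EuclideanSpace ℝ (Fin 3))) '' Q.points))} : ℝ) →
        eStar + κ ≤ Q.energyPerParticle lennardJones) →
    ∀ t : ℝ, 0 < t → ∃ κ : ℝ, 0 < κ ∧ ∀ (N : ℕ) (y : Fin N → EuclideanSpace ℝ (Fin 3)), Function.Injective y →
      (∀ i j : Fin N, i ≠ j → (1 : ℝ) / 3 ≤ dist (y i) (y j)) →
      t * (N : ℝ) ≤ (Nat.card {i : Fin N // ¬ GoodShell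
          ((Measure.count : Measure (EuclideanSpace ℝ (Fin 3))).restrict ((fun z => z - y i) '' Set.range y))} : ℝ) →
      (N : ℝ) * (eStar + κ) ≤ interactionEnergy lennardJones y :=
  SepPeriodicShellGap.stub_sepQualShellNoBoundary_of_sepPeriodicShellGap

/-- **stub_sepReduction_separated** (S15b, LANDED p120852 as `…Theorems.PalmUnimodularRigidityMinimiserShells.SepReduction.stub_sepReduction_separated`, wave-2 worker).  A finite set `Z ⊆ ℝ³` whose Lennard-Jones half double sum does not
decrease under removal of any single point (`½ΣΣ_Z V ≤ ½ΣΣ_(Z ∖ x) V` for all `x ∈ Z`, i.e. every site sum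
`Σ_(z ∈ Z, z ≠ x) V_LJ(|x − z|)` is `≤ 0`, as `V_LJ(0) = 0`) is `1/3`-SEPARATED: at a closest pair `(x₀, z₀)`, `r = |x₀ − z₀|`,
the site sum of `x₀` is `≥ r⁻¹²/12 − (250/6)·r⁻⁶` by the shell sum `sum_inv_pow_six_le` (all pairs of `Z` are `≥ r` apart),
which is `> 0` if `r < 1/3` (`r⁻⁶ > 729 > 500`) — the computation of `LennardJonesMinimalDistance_holds`. -/
theorem stub_sepReduction_separated :
    ∀ Z : Finset (EuclideanSpace ℝ (Fin 3)),
      (∀ x ∈ Z, (∑ a ∈ Z, ∑ b ∈ Z, lennardJones (dist a b)) / 2 ≤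
        (∑ a ∈ Z.erase x, ∑ b ∈ Z.erase x, lennardJones (dist a b)) / 2) →
      ∀ x ∈ Z, ∀ z ∈ Z, x ≠ z → (1 : ℝ) / 3 ≤ dist x z :=
  SepReduction.stub_sepReduction_separated

/-- **stub_sepReduction_bad** (S15d, LANDED p121132 as `…Theorems.PalmUnimodularRigidityMinimiserShells.SepReductionBad.stub_sepReduction_bad`, wave-2 worker).  Removing points from a finite configuration `C` down to a `1/3`-separated
sub-configuration `Z ⊆ C` lowers the number of badly-shelled sites by at most `616` per removed point: a site `x ∈ Z` that is
badly shelled in `C` is badly shelled in `Z` unless some removed point lies within `5/4` of `x` (locality of `GoodShell`: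
`ShellNoBoundary.goodShell_congr_of_local` / `count_restrict_image_sub_singleton_ne_zero_iff`), and at most
`(2·(5/4)/(1/3) + 1)³ = (17/2)³ < 615` points of the `1/3`-separated set `Z` lie within `5/4` of a given removed point
(`card_le_of_separated_of_dist_le`); the removed points themselves number `#C − #Z`. -/
theorem stub_sepReduction_bad :
    ∀ C Z : Finset (EuclideanSpace ℝ (Fin 3)), Z ⊆ C →
      (∀ x ∈ Z, ∀ z ∈ Z, x ≠ z → (1 : ℝ) / 3 ≤ dist x z) →
      (Nat.card {x : C // ¬ GoodShell ((Measure.count : Measure (EuclideanSpace ℝ (Fin 3))).restrict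
          ((fun z => z - (x : EuclideanSpace ℝ (Fin 3))) '' (↑C : Set (EuclideanSpace ℝ (Fin 3)))))} : ℝ) ≤
        (Nat.card {x : Z // ¬ GoodShell ((Measure.count : Measure (EuclideanSpace ℝ (Fin 3))).restrict
          ((fun z => z - (x : EuclideanSpace ℝ (Fin 3))) '' (↑Z : Set (EuclideanSpace ℝ (Fin 3)))))} : ℝ) +
          616 * ((C.card : ℝ) - (Z.card : ℝ)) :=
  SepReductionBad.stub_sepReduction_bad

/-- **stub_qualShellNoBoundary_of_sepQualShellNoBoundary** (S15e, LANDED p121567 as `…Theorems.PalmUnimodularRigidityMinimiserShells.SepReductionAssembly.stub_qualShellNoBoundary_of_sepQualShellNoBoundary`, wave-2b worker).  THE HARD-CORE REDUCTION: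
the finite no-boundary qualitative shell gap for `1/3`-separated configurations implies the general one.  Proof: given `t`, take
`κₛ` from the hypothesis at threshold `t/2` and set `κ := min (κₛ/2) (min (t·|e*|/1234) (|e*|/2))` (`e* < 0`,
`VolumeGrowth.Basics.eStar_neg`).  For `y` injective with `≥ t·N` badly-shelled sites and, for contradiction,
`𝓔_N(y) < N·(e* + κ)`: let `C = range y` (`#C = N`, `½ΣΣ_C V = 𝓔_N(y)` by `two_mul_interactionEnergy_eq_sum_sum_image`) and let
`Z ⊆ C` minimise `½ΣΣ V` over `C.powerset` (`Finset.exists_min_image`).  Then `Z` is `1/3`-separated (S15b), `#Z·e* ≤ ½ΣΣ_Z V ≤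
𝓔_N(y) < N·(e* + κ)` (`card_mul_eStar_le_half_sum_sum`) gives `(N − #Z)·|e*| < N·κ`, so `N − #Z < t·N/1234` and `#Z > N/2`; by
S15d `#bad(Z) ≥ t·N − 616·(N − #Z) ≥ (t/2)·N ≥ (t/2)·#Z`; enumerating `Z` (`Finset.equivFin`, `range_equivFin_symm_val`,
`two_mul_interactionEnergy_equivFin`) the hypothesis yields `#Z·(e* + κₛ) ≤ ½ΣΣ_Z V < N·e* + N·κ ≤ #Z·e* + N·κ`, i.e.
`#Z·κₛ < N·κ ≤ N·κₛ/2`, contradicting `#Z > N/2`. -/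
theorem stub_qualShellNoBoundary_of_sepQualShellNoBoundary :
    (∀ t : ℝ, 0 < t → ∃ κ : ℝ, 0 < κ ∧ ∀ (N : ℕ) (y : Fin N → EuclideanSpace ℝ (Fin 3)), Function.Injective y →
      (∀ i j : Fin N, i ≠ j → (1 : ℝ) / 3 ≤ dist (y i) (y j)) →
      t * (N : ℝ) ≤ (Nat.card {i : Fin N // ¬ GoodShell
          ((Measure.count : Measure (EuclideanSpace ℝ (Fin 3))).restrict ((fun z => z - y i) '' Set.range y))} : ℝ) →
      (N : ℝ) * (eStar + κ) ≤ interactionEnergy lennardJones y) →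
    ∀ t : ℝ, 0 < t → ∃ κ : ℝ, 0 < κ ∧ ∀ (N : ℕ) (y : Fin N → EuclideanSpace ℝ (Fin 3)), Function.Injective y →
      t * (N : ℝ) ≤ (Nat.card {i : Fin N // ¬ GoodShell
          ((Measure.count : Measure (EuclideanSpace ℝ (Fin 3))).restrict ((fun z => z - y i) '' Set.range y))} : ℝ) →
      (N : ℝ) * (eStar + κ) ≤ interactionEnergy lennardJones y :=
  SepReductionAssembly.stub_qualShellNoBoundary_of_sepQualShellNoBoundary

/-! ## Necessity sandwich (registered groundwork, r6, ALL LANDED: N1 p122285, N2 p122552, N3 p122863, N4 p123347; not part of the composition): `MinimiserShells ⇒ S7⁗_loose(θ)`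

The residual S7⁗ implies the crux; conversely the crux implies S7⁗ with the bad-shell predicate loosened by any `θ > 0`
(tolerance `a/100 + θ`, radius `(5/4 − θ)·a`) — `stub_necessity_sandwich`, through the Benjamini–Schramm limit of the
uniformly rooted blocks of a failing sequence (N1), the robustness of good shells under local matching (N2) and the block
bookkeeping (N3).  Exact necessity (`θ = 0`) fails only on the closed-tolerance boundary of `GoodShell` (a matching error of
exactly `a/100` together with an atom at exactly `5a/4`), where the bad-shell event is not closed in the local topology. -/

/-- **stub_necessity_limit** (N1, necessity sandwich, LANDED p122285 as `…Theorems.PalmUnimodularRigidityMinimiserShells.NecessityLimit.stub_necessity_limit`).  The Benjamini–Schramm limit of an ARBITRARY sequence of finite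
injective `1/3`-separated configurations (the construction of item 9230 / `BenjaminiSchrammLimit.exists_limit`, whose ground-state
hypothesis is used only for injectivity and `𝓔 = E(N)`): a subsequence `φ` and a probability law `P` on configurations, a.s.
rooted `1/3`-hard-core, point-stationary (exact finite mass transport passes to the limit), with mean root energy the limit of
`𝓔(y_(φ j))/M_(φ j)` (continuity of the root energy on the compact configuration space), and the CLOSED-SET half of the portmanteau
theorem in density form: for every set `T` of configurations closed under local approximation within the hard-core class and every
`ρ > P(T)`, eventually at most `ρ·M` particles of `y_(φ j)` have their re-rooted configuration in `T`.  Proof: copy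
`BenjaminiSchrammLimit.exists_limit` (empirical laws `emp` on `RootedHardCoreConfig ℝ³ (1/3)`, Prokhorov, `map_reroot_compProd_emp`,
`map_reroot_compProd_eq_of_tendsto`, `isPointStationaryLaw_map_toMeasure`, `integral_rootEnergy_emp`,
`continuous_integral_lennardJones_toMeasure`, measurable embedding `S ↦ count|S`), replacing the open-fattening clause by
`ProbabilityMeasure.limsup_measure_closed_le_of_tendsto` on the closed set `e ⁻¹' T` (closed by `tendsto_iff_locallyMatches` and the
hypothesis on `T`). -/
theorem stub_necessity_limit :
    ∀ (M : ℕ → ℕ) (y : (n : ℕ) → Fin (M n) → EuclideanSpace ℝ (Fin 3)),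
      (∀ n, 0 < M n) → (∀ n, Function.Injective (y n)) →
      (∀ n, ∀ i j : Fin (M n), i ≠ j → (1 : ℝ) / 3 ≤ dist (y n i) (y n j)) →
      ∃ φ : ℕ → ℕ, StrictMono φ ∧ ∃ P : Measure (Measure (EuclideanSpace ℝ (Fin 3))), IsProbabilityMeasure P ∧
        (∀ᵐ μ ∂P, IsRootedHardCore (1 / 3) μ) ∧ IsPointStationaryLaw P ∧
        Filter.Tendsto (fun j : ℕ => interactionEnergy lennardJones (y (φ j)) / (M (φ j) : ℝ)) Filter.atTop
          (nhds (meanRootEnergy P)) ∧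
        ∀ T : Set (Measure (EuclideanSpace ℝ (Fin 3))),
          (∀ μ : Measure (EuclideanSpace ℝ (Fin 3)), IsRootedHardCore (1 / 3) μ →
            (∀ R ε : ℝ, 0 < ε → ∃ ν ∈ T, Literature.Probability.Process.LocallyMatches R ε
              (Literature.Probability.Process.atoms ν) (Literature.Probability.Process.atoms μ)) → μ ∈ T) →
          ∀ ρ : ℝ, (P T).toReal < ρ →
            ∀ᶠ j : ℕ in Filter.atTop, (Nat.card {i : Fin (M (φ j)) //
              ((Measure.count : Measure (EuclideanSpace ℝ (Fin 3))).restrict ((fun z => z - y (φ j) i) '' Set.range (y (φ j)))) ∈ T} : ℝ) ≤ ρ * (M (φ j) : ℝ) :=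
  NecessityLimit.stub_necessity_limit

/-- **stub_necessity_robust** (N2, necessity sandwich, LANDED p122552 as `…NecessityRobust.stub_necessity_robust`).  ROBUSTNESS OF GOOD SHELLS under local matching: if a
`1/3`-hard-core configuration `S` has a good root shell (scale `a`, isometry `A`, `(a/100)`-matching of the twelve shell points,
nothing else within `5a/4`) and `S'` (rooted, `1/3`-hard-core) is `(2, ε)`-matched to `S` with `0 < ε ≤ θ/2 ≤ 1/20`, then `S'` has a
LOOSELY good root shell at tolerance `θ`: the points of `S'` other than `0` within `(5/4 − θ)·a` are exactly the twelve perturbed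
shell points (hard cores make the matching a bijection near the shell: two points of `S` are `≥ 1/3` apart, `2ε < 1/3`), each
within `a/100 + ε ≤ a/100 + θ` of the corresponding point of `A(a·pattern)` (same `a`, same `A`); norms: shell points have
`‖t‖ ≤ 1.01a` so their partners have `‖t'‖ ≤ 1.01a + ε ≤ (5/4 − θ)a`, and a point of `S'` within `(5/4 − θ)a` has a partner in
`S` within `(5/4 − θ)a + ε ≤ 5a/4`, hence among the twelve (or `0`, excluded by `‖·‖ ≥ 1/3 − ε`). -/
theorem stub_necessity_robust :
    ∀ θ : ℝ, 0 < θ → θ ≤ 1 / 10 → ∀ ε : ℝ, 0 < ε → ε ≤ θ / 2 →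
      ∀ S S' : Set (EuclideanSpace ℝ (Fin 3)), (0 : EuclideanSpace ℝ (Fin 3)) ∈ S' →
        (∀ x ∈ S, ∀ z ∈ S, x ≠ z → (1 : ℝ) / 3 ≤ dist x z) →
        (∀ x ∈ S', ∀ z ∈ S', x ≠ z → (1 : ℝ) / 3 ≤ dist x z) →
        Literature.Probability.Process.LocallyMatches 2 ε S S' →
        GoodShell ((Measure.count : Measure (EuclideanSpace ℝ (Fin 3))).restrict S) →
        (∃ a : ℝ, 9 / 10 ≤ a ∧ a ≤ 1 ∧ ∃ T : Finset (EuclideanSpace ℝ (Fin 3)),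
            (↑T : Set (EuclideanSpace ℝ (Fin 3))) = {w : EuclideanSpace ℝ (Fin 3) | ((Measure.count : Measure (EuclideanSpace ℝ (Fin 3))).restrict S') {w} ≠ 0 ∧ w ≠ 0 ∧ ‖w‖ ≤ (5 / 4 - θ) * a} ∧
            (Literature.Geometry.DiscreteGeometry.ShellCloseTo (a / 100 + θ) T
              (Finset.image (fun v : EuclideanSpace ℝ (Fin 3) => a • v) Literature.Geometry.DiscreteGeometry.fccKissingPattern) ∨
             Literature.Geometry.DiscreteGeometry.ShellCloseTo (a / 100 + θ) T
              (Finset.image (fun v : EuclideanSpace ℝ (Fin 3) => a • v) Literature.Geometry.DiscreteGeometry.hcpKissingPattern))) :=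
  NecessityRobust.stub_necessity_robust

/-- **stub_necessity_blocks** (N3, necessity sandwich, LANDED p122863 as `…NecessityBlocks.stub_necessity_blocks`).  BLOCKS OF A HARD-CORE PERIODIC CONFIGURATION WITH MANY
LOOSELY-BAD SITES are finite injective `1/3`-separated configurations with almost the same loosely-bad fraction and almost the same
energy per particle: the `K³`-blocks `blockConfig Q K` (`ChargedEnergyGapNegative.Blocks`) have `𝓔 ≤ #F·K³·(e(Q) + ε)` for
`K ≥ K₀` (`exists_block_energy_le`), inherit the separation of `Q.points`, and a block point over a loosely-bad motif site whose
lattice coordinates are `depth Q 2`-deep is loosely bad in the block (locality: the loose predicate reads only `B̄(0, (5/4 − θ)a) ⊆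
B̄(0, 5/4)` for `θ ≥ 0`; lattice invariance of `Q.points`), all but `≤ 6·depth·K²` coordinates being deep — exactly the proof of S14
(`PeriodicShellGapConverse`, helpers `image_sub_bpt_points`, `points_inter_closedBall_subset_range`, `card_bad_block_ge`) with the
loose predicate. -/
theorem stub_necessity_blocks :
    ∀ θ : ℝ, 0 ≤ θ → ∀ Q : Literature.MathematicalPhysics.StatisticalMechanics.PeriodicConfiguration 3,
      (∀ p ∈ Q.points, ∀ q ∈ Q.points, p ≠ q → (1 : ℝ) / 3 ≤ dist p q) →
      ∀ t : ℝ, t * (Q.motif.card : ℝ) ≤ (Nat.card {x : Q.motif // ¬ (∃ a : ℝ, 9 / 10 ≤ a ∧ a ≤ 1 ∧ ∃ T : Finset (EuclideanSpace ℝ (Fin 3)),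
            (↑T : Set (EuclideanSpace ℝ (Fin 3))) = {w : EuclideanSpace ℝ (Fin 3) | ((Measure.count : Measure (EuclideanSpace ℝ (Fin 3))).restrict ((fun z => z - (x : EuclideanSpace ℝ (Fin 3))) '' Q.points)) {w} ≠ 0 ∧ w ≠ 0 ∧ ‖w‖ ≤ (5 / 4 - θ) * a} ∧
            (Literature.Geometry.DiscreteGeometry.ShellCloseTo (a / 100 + θ) T
              (Finset.image (fun v : EuclideanSpace ℝ (Fin 3) => a • v) Literature.Geometry.DiscreteGeometry.fccKissingPattern) ∨
             Literature.Geometry.DiscreteGeometry.ShellCloseTo (a / 100 + θ) T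
              (Finset.image (fun v : EuclideanSpace ℝ (Fin 3) => a • v) Literature.Geometry.DiscreteGeometry.hcpKissingPattern)))} : ℝ) →
      ∀ ε : ℝ, 0 < ε → ∃ N : ℕ, 0 < N ∧ ∃ y : Fin N → EuclideanSpace ℝ (Fin 3), Function.Injective y ∧
        (∀ i j : Fin N, i ≠ j → (1 : ℝ) / 3 ≤ dist (y i) (y j)) ∧
        interactionEnergy lennardJones y ≤ (N : ℝ) * (Q.energyPerParticle lennardJones + ε) ∧
        (t - ε) * (N : ℝ) ≤ (Nat.card {i : Fin N // ¬ (∃ a : ℝ, 9 / 10 ≤ a ∧ a ≤ 1 ∧ ∃ T : Finset (EuclideanSpace ℝ (Fin 3)),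
            (↑T : Set (EuclideanSpace ℝ (Fin 3))) = {w : EuclideanSpace ℝ (Fin 3) | ((Measure.count : Measure (EuclideanSpace ℝ (Fin 3))).restrict ((fun z => z - y i) '' Set.range y)) {w} ≠ 0 ∧ w ≠ 0 ∧ ‖w‖ ≤ (5 / 4 - θ) * a} ∧
            (Literature.Geometry.DiscreteGeometry.ShellCloseTo (a / 100 + θ) T
              (Finset.image (fun v : EuclideanSpace ℝ (Fin 3) => a • v) Literature.Geometry.DiscreteGeometry.fccKissingPattern) ∨
             Literature.Geometry.DiscreteGeometry.ShellCloseTo (a / 100 + θ) T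
              (Finset.image (fun v : EuclideanSpace ℝ (Fin 3) => a • v) Literature.Geometry.DiscreteGeometry.hcpKissingPattern)))} : ℝ) :=
  NecessityBlocks.stub_necessity_blocks

/-- **stub_necessity_sandwich** (N4, necessity sandwich, LANDED p123347 as `…NecessitySandwich.stub_necessity_sandwich`).  THE CRUX IMPLIES THE HARD-CORE PERIODIC
SHELL GAP WITH ANY MARGINALLY LOOSER BAD-SHELL PREDICATE: if `MinimiserShells` holds then for every `θ ∈ (0, 1/10]` and `t > 0`
there is `κ > 0` such that every `1/3`-hard-core periodic configuration with at least `t·#F` motif sites that are not even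
LOOSELY well-shelled (tolerance `a/100 + θ`, radius `(5/4 − θ)a`) has `e(Q) ≥ e* + κ`.  With S7⁗ ⇒ `MinimiserShells`
(`OfSepPeriodicShellGap.minimiserShells_of_sepPeriodicShellGap`) this sandwiches the crux between the residual stub S7⁗ (`θ = 0`)
and its `θ`-loosenings.  Proof: if not, choose `Q_n` violating with `κ = 1/(n+1)`; N3 (`ε = min (t/2) (1/(n+1))`) gives finite
injective `1/3`-separated `y_n` with loosely-bad fraction `≥ t/2` and `e* ≤ 𝓔(y_n)/M_n ≤ e(Q_n) + 1/(n+1) < e* + 2/(n+1)`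
(`card_mul_eStar_le`); N1 gives `φ`, `P` with `meanRootEnergy P = e*` (uniqueness of limits), so the crux (`minimiserShells_iff`)
makes the root shell `P`-a.s. GOOD; let `T` := hard-core configurations locally approximable by hard-core loosely-bad ones — it
contains every loosely-bad re-rooted `y_n`, is closed under local approximation (`LocallyMatches.trans`), and by N2 (with
`IsRootedHardCore.eq_count_restrict_atoms`) contains no configuration with a good shell, so `P(T) = 0`; the closed-set clause of N1
with `ρ = t/4` then bounds the loosely-bad count of `y_(φ j)` by `(t/4)·M` eventually, against `≥ (t/2)·M`. -/
theorem stub_necessity_sandwich :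
    MinimiserShells →
    ∀ θ : ℝ, 0 < θ → θ ≤ 1 / 10 → ∀ t : ℝ, 0 < t → ∃ κ : ℝ, 0 < κ ∧
      ∀ Q : Literature.MathematicalPhysics.StatisticalMechanics.PeriodicConfiguration 3,
        (∀ p ∈ Q.points, ∀ q ∈ Q.points, p ≠ q → (1 : ℝ) / 3 ≤ dist p q) →
        t * (Q.motif.card : ℝ) ≤ (Nat.card {x : Q.motif // ¬ (∃ a : ℝ, 9 / 10 ≤ a ∧ a ≤ 1 ∧ ∃ T : Finset (EuclideanSpace ℝ (Fin 3)),
            (↑T : Set (EuclideanSpace ℝ (Fin 3))) = {w : EuclideanSpace ℝ (Fin 3) | ((Measure.count : Measure (EuclideanSpace ℝ (Fin 3))).restrict ((fun z => z - (x : EuclideanSpace ℝ (Fin 3))) '' Q.points)) {w} ≠ 0 ∧ w ≠ 0 ∧ ‖w‖ ≤ (5 / 4 - θ) * a} ∧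
            (Literature.Geometry.DiscreteGeometry.ShellCloseTo (a / 100 + θ) T
              (Finset.image (fun v : EuclideanSpace ℝ (Fin 3) => a • v) Literature.Geometry.DiscreteGeometry.fccKissingPattern) ∨
             Literature.Geometry.DiscreteGeometry.ShellCloseTo (a / 100 + θ) T
              (Finset.image (fun v : EuclideanSpace ℝ (Fin 3) => a • v) Literature.Geometry.DiscreteGeometry.hcpKissingPattern)))} : ℝ) →
        eStar + κ ≤ Q.energyPerParticle lennardJones :=
  NecessitySandwich.stub_necessity_sandwich

/-! ## Derived statements of r5 (no `sorry`): S7‴ from S7⁗ -/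

/-- **S7⁗ ⇒ finite no-boundary qualitative shell gap** (S16 then S15e). -/
theorem qualShellNoBoundary_of_sepPeriodicShellGap
    (hSep : ∀ t : ℝ, 0 < t → ∃ κ : ℝ, 0 < κ ∧
      ∀ Q : Literature.MathematicalPhysics.StatisticalMechanics.PeriodicConfiguration 3,
        (∀ p ∈ Q.points, ∀ q ∈ Q.points, p ≠ q → (1 : ℝ) / 3 ≤ dist p q) →
        t * (Q.motif.card : ℝ) ≤ (Nat.card {x : Q.motif // ¬ GoodShell
            ((Measure.count : Measure (EuclideanSpace ℝ (Fin 3))).restrict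
              ((fun z => z - (x : EuclideanSpace ℝ (Fin 3))) '' Q.points))} : ℝ) →
        eStar + κ ≤ Q.energyPerParticle lennardJones) :
    ∀ t : ℝ, 0 < t → ∃ κ : ℝ, 0 < κ ∧ ∀ (N : ℕ) (y : Fin N → EuclideanSpace ℝ (Fin 3)), Function.Injective y →
      t * (N : ℝ) ≤ (Nat.card {i : Fin N // ¬ GoodShell
          ((Measure.count : Measure (EuclideanSpace ℝ (Fin 3))).restrict ((fun z => z - y i) '' Set.range y))} : ℝ) →
      (N : ℝ) * (eStar + κ) ≤ interactionEnergy lennardJones y :=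
  stub_qualShellNoBoundary_of_sepQualShellNoBoundary (stub_sepQualShellNoBoundary_of_sepPeriodicShellGap hSep)

/-- **stub_periodicShellGap** (S7‴, r5's residual) — from r6 on DERIVED from S7⁗ (S16, S15e, then S14
`PeriodicShellGapConverse.stub_periodicShellGap_of_qualShellNoBoundary`).  The QUALITATIVE PERIODIC SHELL GAP: for every
threshold `t > 0` there is an excess `κ > 0` such that every periodic configuration `Q` of `ℝ³` in which at least `t·#F` motif
sites `x` are badly shelled IN THE INFINITE POINT SET `Q.points` has `e(Q) ≥ e* + κ`; equivalently every sequence of periodic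
configurations with `e(Q_n) → e*` has bad-shell fraction `→ 0`.  It implies the crux (S13 → S11 → S8b(S8a); tree theorem
`OfPeriodicShellGap.minimiserShells_of_periodicShellGap`, p120178) and is equivalent to the finite forms (p120178). -/
theorem stub_periodicShellGap :
    ∀ t : ℝ, 0 < t → ∃ κ : ℝ, 0 < κ ∧
      ∀ Q : Literature.MathematicalPhysics.StatisticalMechanics.PeriodicConfiguration 3,
        t * (Q.motif.card : ℝ) ≤ (Nat.card {x : Q.motif // ¬ GoodShell
            ((Measure.count : Measure (EuclideanSpace ℝ (Fin 3))).restrict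
              ((fun z => z - (x : EuclideanSpace ℝ (Fin 3))) '' Q.points))} : ℝ) →
        eStar + κ ≤ Q.energyPerParticle lennardJones :=
  PeriodicShellGapConverse.stub_periodicShellGap_of_qualShellNoBoundary
    (qualShellNoBoundary_of_sepPeriodicShellGap stub_sepPeriodicShellGap)

/-- **S7‴ ⇔ S7⁗**: the periodic shell gap is equivalent to its restriction to `1/3`-hard-core periodic configurations. -/
theorem periodicShellGap_iff_sepPeriodicShellGap :
    (∀ t : ℝ, 0 < t → ∃ κ : ℝ, 0 < κ ∧
      ∀ Q : Literature.MathematicalPhysics.StatisticalMechanics.PeriodicConfiguration 3,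
        t * (Q.motif.card : ℝ) ≤ (Nat.card {x : Q.motif // ¬ GoodShell
            ((Measure.count : Measure (EuclideanSpace ℝ (Fin 3))).restrict
              ((fun z => z - (x : EuclideanSpace ℝ (Fin 3))) '' Q.points))} : ℝ) →
        eStar + κ ≤ Q.energyPerParticle lennardJones) ↔
    (∀ t : ℝ, 0 < t → ∃ κ : ℝ, 0 < κ ∧
      ∀ Q : Literature.MathematicalPhysics.StatisticalMechanics.PeriodicConfiguration 3,
        (∀ p ∈ Q.points, ∀ q ∈ Q.points, p ≠ q → (1 : ℝ) / 3 ≤ dist p q) →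
        t * (Q.motif.card : ℝ) ≤ (Nat.card {x : Q.motif // ¬ GoodShell
            ((Measure.count : Measure (EuclideanSpace ℝ (Fin 3))).restrict
              ((fun z => z - (x : EuclideanSpace ℝ (Fin 3))) '' Q.points))} : ℝ) →
        eStar + κ ≤ Q.energyPerParticle lennardJones) :=
  ⟨fun h t ht => by
    obtain ⟨κ, hκ, hQ⟩ := h t ht
    exact ⟨κ, hκ, fun Q _ hbad => hQ Q hbad⟩,
   fun h => PeriodicShellGapConverse.stub_periodicShellGap_of_qualShellNoBoundary
    (stub_qualShellNoBoundary_of_sepQualShellNoBoundary (stub_sepQualShellNoBoundary_of_sepPeriodicShellGap h))⟩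

/-- **stub_qualShellNoBoundary_of_periodicShellGap** (S13, LANDED p119483 as
`…Theorems.PalmUnimodularRigidityMinimiserShells.PeriodicShellGap.stub_qualShellNoBoundary_of_periodicShellGap`, wave-1 worker).  The periodic shell gap implies the finite no-boundary
qualitative shell gap (S11's hypothesis), with the SAME `κ` for each `t`.  Proof: `N = 0` is `0 ≤ 0`; for `N ≥ 1` periodise
`y` with the cubic lattice of period `2Σ‖yᵢ‖ + 2` (`ChargedEnergyGapNegative.periodise`): points of the periodisation other than
the `yⱼ` are at distance `≥ 2` from every `yᵢ` (`two_le_dist_of_mem_points`), so by locality of the shell predicate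
(`ShellNoBoundary.goodShell_count_restrict_image_sub_congr` with `R₀ = 3/2`) the motif site `yᵢ` is badly shelled in the
infinite point set iff index `i` is badly shelled in `y`; hence `#bad motif = #bad(y) ≥ t·N = t·#motif`, and
`e* + κ ≤ e(Q) ≤ 𝓔_N(y)/N` (`energyPerParticle_periodise_le`: `V_LJ ≤ 0` beyond `2^{-1/6}`). -/
theorem stub_qualShellNoBoundary_of_periodicShellGap :
    (∀ t : ℝ, 0 < t → ∃ κ : ℝ, 0 < κ ∧
      ∀ Q : Literature.MathematicalPhysics.StatisticalMechanics.PeriodicConfiguration 3,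
        t * (Q.motif.card : ℝ) ≤ (Nat.card {x : Q.motif // ¬ GoodShell
            ((Measure.count : Measure (EuclideanSpace ℝ (Fin 3))).restrict
              ((fun z => z - (x : EuclideanSpace ℝ (Fin 3))) '' Q.points))} : ℝ) →
        eStar + κ ≤ Q.energyPerParticle lennardJones) →
    ∀ t : ℝ, 0 < t → ∃ κ : ℝ, 0 < κ ∧ ∀ (N : ℕ) (y : Fin N → EuclideanSpace ℝ (Fin 3)), Function.Injective y →
      t * (N : ℝ) ≤ (Nat.card {i : Fin N // ¬ GoodShell
          ((Measure.count : Measure (EuclideanSpace ℝ (Fin 3))).restrict ((fun z => z - y i) '' Set.range y))} : ℝ) →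
      (N : ℝ) * (eStar + κ) ≤ interactionEnergy lennardJones y :=
  PeriodicShellGap.stub_qualShellNoBoundary_of_periodicShellGap

/-- **stub_periodicShellGap_of_qualShellNoBoundary** (S14, LANDED p119995 as
`…Theorems.PalmUnimodularRigidityMinimiserShells.PeriodicShellGapConverse.stub_periodicShellGap_of_qualShellNoBoundary`, wave-1 worker).  Conversely, the finite no-boundary qualitative shell gap
implies the periodic shell gap (threshold `t` from the finite statement at `t/2`, same `κ`).  Proof: fix `Q` with `≥ t·#F` badly
shelled motif sites and take the `K³`-blocks `blockConfig Q K` (`ChargedEnergyGapNegative.Blocks`): they are injective, have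
`#F·K³` points and energy `≤ #F·K³·(e(Q) + ε)` for `K ≥ K₀(ε)` (`Blocks.exists_block_energy_le`); a block point over a badly
shelled motif site whose lattice coordinates are deep (`IsDeep K (depth Q 2)`, all but `≤ 6·depth·K²` coordinates,
`Blocks.card_not_deep_le`) sees within distance `< 2` only block points (`Blocks.exists_eq_toP_of_dist_lt`), so by locality and
lattice invariance of `Q.points` it is badly shelled in the block; hence `#bad(block) ≥ (K³ − 6·depth·K²)·t·#F ≥ (t/2)·#F·K³`
for large `K`, and the finite gap gives `e* + κ ≤ e(Q) + ε` for every `ε > 0`. -/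
theorem stub_periodicShellGap_of_qualShellNoBoundary :
    (∀ t : ℝ, 0 < t → ∃ κ : ℝ, 0 < κ ∧ ∀ (N : ℕ) (y : Fin N → EuclideanSpace ℝ (Fin 3)), Function.Injective y →
      t * (N : ℝ) ≤ (Nat.card {i : Fin N // ¬ GoodShell
          ((Measure.count : Measure (EuclideanSpace ℝ (Fin 3))).restrict ((fun z => z - y i) '' Set.range y))} : ℝ) →
      (N : ℝ) * (eStar + κ) ≤ interactionEnergy lennardJones y) →
    ∀ t : ℝ, 0 < t → ∃ κ : ℝ, 0 < κ ∧
      ∀ Q : Literature.MathematicalPhysics.StatisticalMechanics.PeriodicConfiguration 3,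
        t * (Q.motif.card : ℝ) ≤ (Nat.card {x : Q.motif // ¬ GoodShell
            ((Measure.count : Measure (EuclideanSpace ℝ (Fin 3))).restrict
              ((fun z => z - (x : EuclideanSpace ℝ (Fin 3))) '' Q.points))} : ℝ) →
        eStar + κ ≤ Q.energyPerParticle lennardJones :=
  PeriodicShellGapConverse.stub_periodicShellGap_of_qualShellNoBoundary

/-! ## Composition (real proofs, no `sorry` below this line) -/

/-- **Composition r5 (the skeleton theorem).**  Periodic shell gap →(S13) finite no-boundary qualitative shell gap →(S11)
threshold pricing on cube windows →(S8b, with S8a) the crux, BY NAME. -/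
theorem MinimiserShells_of''''
    (hPer : ∀ t : ℝ, 0 < t → ∃ κ : ℝ, 0 < κ ∧
      ∀ Q : Literature.MathematicalPhysics.StatisticalMechanics.PeriodicConfiguration 3,
        t * (Q.motif.card : ℝ) ≤ (Nat.card {x : Q.motif // ¬ GoodShell
            ((Measure.count : Measure (EuclideanSpace ℝ (Fin 3))).restrict
              ((fun z => z - (x : EuclideanSpace ℝ (Fin 3))) '' Q.points))} : ℝ) →
        eStar + κ ≤ Q.energyPerParticle lennardJones)
    (hS13 : (∀ t : ℝ, 0 < t → ∃ κ : ℝ, 0 < κ ∧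
      ∀ Q : Literature.MathematicalPhysics.StatisticalMechanics.PeriodicConfiguration 3,
        t * (Q.motif.card : ℝ) ≤ (Nat.card {x : Q.motif // ¬ GoodShell
            ((Measure.count : Measure (EuclideanSpace ℝ (Fin 3))).restrict
              ((fun z => z - (x : EuclideanSpace ℝ (Fin 3))) '' Q.points))} : ℝ) →
        eStar + κ ≤ Q.energyPerParticle lennardJones) →
      ∀ t : ℝ, 0 < t → ∃ κ : ℝ, 0 < κ ∧ ∀ (N : ℕ) (y : Fin N → EuclideanSpace ℝ (Fin 3)), Function.Injective y →
        t * (N : ℝ) ≤ (Nat.card {i : Fin N // ¬ GoodShell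
            ((Measure.count : Measure (EuclideanSpace ℝ (Fin 3))).restrict ((fun z => z - y i) '' Set.range y))} : ℝ) →
        (N : ℝ) * (eStar + κ) ≤ interactionEnergy lennardJones y)
    (hS11 : (∀ t : ℝ, 0 < t → ∃ κ : ℝ, 0 < κ ∧ ∀ (N : ℕ) (y : Fin N → EuclideanSpace ℝ (Fin 3)), Function.Injective y →
      t * (N : ℝ) ≤ (Nat.card {i : Fin N // ¬ GoodShell
          ((Measure.count : Measure (EuclideanSpace ℝ (Fin 3))).restrict ((fun z => z - y i) '' Set.range y))} : ℝ) →
      (N : ℝ) * (eStar + κ) ≤ interactionEnergy lennardJones y) →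
      ∀ δ : ℝ, 0 < δ → ∀ t : ℝ, 0 < t → ∃ L₀ R₀ κ : ℝ, 0 < L₀ ∧ 0 < R₀ ∧ 0 < κ ∧
        ∀ S : Set (EuclideanSpace ℝ (Fin 3)), (∀ x ∈ S, ∀ z ∈ S, x ≠ z → δ ≤ dist x z) →
          IsMuGSC lennardJones eStar S →
          ∀ L : ℝ, L₀ ≤ L → ∀ a : Fin 3 → ℝ, ∀ C : Finset (EuclideanSpace ℝ (Fin 3)),
            (↑C : Set (EuclideanSpace ℝ (Fin 3))) =
              S ∩ {z : EuclideanSpace ℝ (Fin 3) | ∀ i, a i ≤ z i ∧ z i < a i + L} →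
          ∀ G : Finset (EuclideanSpace ℝ (Fin 3)), G ⊆ C →
            (∀ y ∈ G, ¬ GoodShell ((Measure.count : Measure (EuclideanSpace ℝ (Fin 3))).restrict
                ((fun z => z - y) '' S)) ∧ S ∩ Metric.closedBall y R₀ ⊆ ↑C) →
            t * (C.card : ℝ) ≤ (G.card : ℝ) →
            (C.card : ℝ) * (eStar + κ) ≤ (∑ x ∈ C, ∑ z ∈ C, lennardJones (dist x z)) / 2)
    (hSlack : ∀ δ : ℝ, 0 < δ → ∀ P : Measure (Measure (EuclideanSpace ℝ (Fin 3))), IsProbabilityMeasure P →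
      (∀ᵐ μ ∂P, IsRootedHardCore δ μ) → IsPointStationaryLaw P → meanRootEnergy P ≤ eStar →
      ∀ K : Set (EuclideanSpace ℝ (Fin 3)) → Prop,
      (∀ᵐ μ ∂P, ∃ S : Set (EuclideanSpace ℝ (Fin 3)),
        μ = (Measure.count : Measure (EuclideanSpace ℝ (Fin 3))).restrict S ∧ K S) →
      ∀ Ev : Set (Measure (EuclideanSpace ℝ (Fin 3))), MeasurableSet Ev →
      ∀ L₀ R₀ c s : ℝ, 0 < L₀ → 0 < R₀ → 0 < c → 0 ≤ s →
      (∀ S : Set (EuclideanSpace ℝ (Fin 3)), (∀ x ∈ S, ∀ z ∈ S, x ≠ z → δ ≤ dist x z) → K S →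
        ∀ L : ℝ, L₀ ≤ L → ∀ a : Fin 3 → ℝ, ∀ C : Finset (EuclideanSpace ℝ (Fin 3)),
        (↑C : Set (EuclideanSpace ℝ (Fin 3))) = S ∩ {z : EuclideanSpace ℝ (Fin 3) | ∀ i, a i ≤ z i ∧ z i < a i + L} →
        ∀ G : Finset (EuclideanSpace ℝ (Fin 3)), G ⊆ C →
          (∀ y ∈ G, (Measure.count : Measure (EuclideanSpace ℝ (Fin 3))).restrict ((fun z => z - y) '' S) ∈ Ev ∧
            S ∩ Metric.closedBall y R₀ ⊆ ↑C) →
          (C.card : ℝ) * eStar + c * G.card ≤ (∑ x ∈ C, ∑ z ∈ C, lennardJones (dist x z)) / 2 + s * C.card) →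
      P Ev ≤ ENNReal.ofReal (s / c))
    (hTransfer : (∀ δ : ℝ, 0 < δ → ∀ P : Measure (Measure (EuclideanSpace ℝ (Fin 3))), IsProbabilityMeasure P →
      (∀ᵐ μ ∂P, IsRootedHardCore δ μ) → IsPointStationaryLaw P → meanRootEnergy P ≤ eStar →
      ∀ K : Set (EuclideanSpace ℝ (Fin 3)) → Prop,
      (∀ᵐ μ ∂P, ∃ S : Set (EuclideanSpace ℝ (Fin 3)),
        μ = (Measure.count : Measure (EuclideanSpace ℝ (Fin 3))).restrict S ∧ K S) →
      ∀ Ev : Set (Measure (EuclideanSpace ℝ (Fin 3))), MeasurableSet Ev →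
      ∀ L₀ R₀ c s : ℝ, 0 < L₀ → 0 < R₀ → 0 < c → 0 ≤ s →
      (∀ S : Set (EuclideanSpace ℝ (Fin 3)), (∀ x ∈ S, ∀ z ∈ S, x ≠ z → δ ≤ dist x z) → K S →
        ∀ L : ℝ, L₀ ≤ L → ∀ a : Fin 3 → ℝ, ∀ C : Finset (EuclideanSpace ℝ (Fin 3)),
        (↑C : Set (EuclideanSpace ℝ (Fin 3))) = S ∩ {z : EuclideanSpace ℝ (Fin 3) | ∀ i, a i ≤ z i ∧ z i < a i + L} →
        ∀ G : Finset (EuclideanSpace ℝ (Fin 3)), G ⊆ C →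
          (∀ y ∈ G, (Measure.count : Measure (EuclideanSpace ℝ (Fin 3))).restrict ((fun z => z - y) '' S) ∈ Ev ∧
            S ∩ Metric.closedBall y R₀ ⊆ ↑C) →
          (C.card : ℝ) * eStar + c * G.card ≤ (∑ x ∈ C, ∑ z ∈ C, lennardJones (dist x z)) / 2 + s * C.card) →
      P Ev ≤ ENNReal.ofReal (s / c)) →
      (∀ δ : ℝ, 0 < δ → ∀ t : ℝ, 0 < t → ∃ L₀ R₀ κ : ℝ, 0 < L₀ ∧ 0 < R₀ ∧ 0 < κ ∧
      ∀ S : Set (EuclideanSpace ℝ (Fin 3)), (∀ x ∈ S, ∀ z ∈ S, x ≠ z → δ ≤ dist x z) →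
        IsMuGSC lennardJones eStar S →
        ∀ L : ℝ, L₀ ≤ L → ∀ a : Fin 3 → ℝ, ∀ C : Finset (EuclideanSpace ℝ (Fin 3)),
          (↑C : Set (EuclideanSpace ℝ (Fin 3))) =
            S ∩ {z : EuclideanSpace ℝ (Fin 3) | ∀ i, a i ≤ z i ∧ z i < a i + L} →
        ∀ G : Finset (EuclideanSpace ℝ (Fin 3)), G ⊆ C →
          (∀ y ∈ G, ¬ GoodShell ((Measure.count : Measure (EuclideanSpace ℝ (Fin 3))).restrict
              ((fun z => z - y) '' S)) ∧ S ∩ Metric.closedBall y R₀ ⊆ ↑C) →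
          t * (C.card : ℝ) ≤ (G.card : ℝ) →
          (C.card : ℝ) * (eStar + κ) ≤ (∑ x ∈ C, ∑ z ∈ C, lennardJones (dist x z)) / 2) →
      MinimiserShells) :
    MinimiserShells :=
  hTransfer hSlack (hS11 (hS13 hPer))

/-- **The crux as a closed term over the registered stubs** — CLOSED MODULO {S7‴} = {`stub_periodicShellGap`} only
(S13 p119483, S14 p119995 landed in reshape r5; S8a, S8b, S11 in r4). -/
theorem MinimiserShells_proof : MinimiserShells :=
  MinimiserShells_of'''' stub_periodicShellGap stub_qualShellNoBoundary_of_periodicShellGap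
    stub_thresholdBadPricing_of_qualShellNoBoundary stub_slackEventTransfer stub_thresholdTransfer

/-- **S7‴ ⇒ S7″**: the periodic shell gap implies r4's threshold pricing on large cube windows of e*-`μ`GSCs (through S13 and
S11; `L₀ = 1`, `R₀ = 2`), so r4's residual is a consequence of r5's. -/
theorem thresholdBadPricing_of_periodicShellGap
    (hPer : ∀ t : ℝ, 0 < t → ∃ κ : ℝ, 0 < κ ∧
      ∀ Q : Literature.MathematicalPhysics.StatisticalMechanics.PeriodicConfiguration 3,
        t * (Q.motif.card : ℝ) ≤ (Nat.card {x : Q.motif // ¬ GoodShell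
            ((Measure.count : Measure (EuclideanSpace ℝ (Fin 3))).restrict
              ((fun z => z - (x : EuclideanSpace ℝ (Fin 3))) '' Q.points))} : ℝ) →
        eStar + κ ≤ Q.energyPerParticle lennardJones) :
    ∀ δ : ℝ, 0 < δ → ∀ t : ℝ, 0 < t → ∃ L₀ R₀ κ : ℝ, 0 < L₀ ∧ 0 < R₀ ∧ 0 < κ ∧
      ∀ S : Set (EuclideanSpace ℝ (Fin 3)), (∀ x ∈ S, ∀ z ∈ S, x ≠ z → δ ≤ dist x z) →
        IsMuGSC lennardJones eStar S →
        ∀ L : ℝ, L₀ ≤ L → ∀ a : Fin 3 → ℝ, ∀ C : Finset (EuclideanSpace ℝ (Fin 3)),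
          (↑C : Set (EuclideanSpace ℝ (Fin 3))) =
            S ∩ {z : EuclideanSpace ℝ (Fin 3) | ∀ i, a i ≤ z i ∧ z i < a i + L} →
        ∀ G : Finset (EuclideanSpace ℝ (Fin 3)), G ⊆ C →
          (∀ y ∈ G, ¬ GoodShell ((Measure.count : Measure (EuclideanSpace ℝ (Fin 3))).restrict
              ((fun z => z - y) '' S)) ∧ S ∩ Metric.closedBall y R₀ ⊆ ↑C) →
          t * (C.card : ℝ) ≤ (G.card : ℝ) →
          (C.card : ℝ) * (eStar + κ) ≤ (∑ x ∈ C, ∑ z ∈ C, lennardJones (dist x z)) / 2 :=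
  stub_thresholdBadPricing_of_qualShellNoBoundary (stub_qualShellNoBoundary_of_periodicShellGap hPer)

/-- **S7‴ ⇔ S11's hypothesis** (S13 ∧ S14): the periodic shell gap and the finite no-boundary qualitative shell gap are the
same statement — r5's registered residual is not stronger than r4's finite sufficient form. -/
theorem periodicShellGap_iff_qualShellNoBoundary :
    (∀ t : ℝ, 0 < t → ∃ κ : ℝ, 0 < κ ∧
      ∀ Q : Literature.MathematicalPhysics.StatisticalMechanics.PeriodicConfiguration 3,
        t * (Q.motif.card : ℝ) ≤ (Nat.card {x : Q.motif // ¬ GoodShell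
            ((Measure.count : Measure (EuclideanSpace ℝ (Fin 3))).restrict
              ((fun z => z - (x : EuclideanSpace ℝ (Fin 3))) '' Q.points))} : ℝ) →
        eStar + κ ≤ Q.energyPerParticle lennardJones) ↔
    (∀ t : ℝ, 0 < t → ∃ κ : ℝ, 0 < κ ∧ ∀ (N : ℕ) (y : Fin N → EuclideanSpace ℝ (Fin 3)), Function.Injective y →
      t * (N : ℝ) ≤ (Nat.card {i : Fin N // ¬ GoodShell
          ((Measure.count : Measure (EuclideanSpace ℝ (Fin 3))).restrict ((fun z => z - y i) '' Set.range y))} : ℝ) →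
      (N : ℝ) * (eStar + κ) ≤ interactionEnergy lennardJones y) :=
  ⟨stub_qualShellNoBoundary_of_periodicShellGap, stub_periodicShellGap_of_qualShellNoBoundary⟩

/-- **The qualitative finite-`N` gap with allowance also gives S7‴** (S12 then S14): all three finite/periodic forms agree. -/
theorem periodicShellGap_of_qualShellGapWith
    (hGap : ∀ t : ℝ, 0 < t → ∃ κ C₀ : ℝ, 0 < κ ∧ ∀ (N : ℕ) (y : Fin N → EuclideanSpace ℝ (Fin 3)),
      Function.Injective y →
      t * (N : ℝ) ≤ (Nat.card {i : Fin N // ¬ GoodShell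
          ((Measure.count : Measure (EuclideanSpace ℝ (Fin 3))).restrict ((fun z => z - y i) '' Set.range y))} : ℝ) →
      (N : ℝ) * (eStar + κ) - C₀ * (N : ℝ) ^ (2 / 3 : ℝ) ≤ interactionEnergy lennardJones y) :
    ∀ t : ℝ, 0 < t → ∃ κ : ℝ, 0 < κ ∧
      ∀ Q : Literature.MathematicalPhysics.StatisticalMechanics.PeriodicConfiguration 3,
        t * (Q.motif.card : ℝ) ≤ (Nat.card {x : Q.motif // ¬ GoodShell
            ((Measure.count : Measure (EuclideanSpace ℝ (Fin 3))).restrict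
              ((fun z => z - (x : EuclideanSpace ℝ (Fin 3))) '' Q.points))} : ℝ) →
        eStar + κ ≤ Q.energyPerParticle lennardJones :=
  stub_periodicShellGap_of_qualShellNoBoundary (stub_qualShellNoBoundary_of_qualShellGapWith hGap)

/-! ## Composition r4 (kept: S7″ as a HYPOTHESIS; its stubs S8a, S8b landed) -/

/-- **r3 ⇒ r4**: linear deep pricing implies threshold pricing (`κ = c·t`, same `R₀`). -/
theorem thresholdBadPricing_of_deepBadPricing
    (hPrice : ∀ δ : ℝ, 0 < δ → ∃ R₀ c : ℝ, 0 < R₀ ∧ 0 < c ∧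
      ∀ S : Set (EuclideanSpace ℝ (Fin 3)), (∀ x ∈ S, ∀ z ∈ S, x ≠ z → δ ≤ dist x z) →
        IsMuGSC lennardJones eStar S →
        ∀ C : Finset (EuclideanSpace ℝ (Fin 3)), (↑C : Set (EuclideanSpace ℝ (Fin 3))) ⊆ S →
        ∀ G : Finset (EuclideanSpace ℝ (Fin 3)), G ⊆ C →
          (∀ y ∈ G, ¬ GoodShell ((Measure.count : Measure (EuclideanSpace ℝ (Fin 3))).restrict
              ((fun z => z - y) '' S)) ∧ S ∩ Metric.closedBall y R₀ ⊆ ↑C) →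
          (C.card : ℝ) * eStar + c * G.card ≤ (∑ x ∈ C, ∑ z ∈ C, lennardJones (dist x z)) / 2) :
    ∀ δ : ℝ, 0 < δ → ∀ t : ℝ, 0 < t → ∃ L₀ R₀ κ : ℝ, 0 < L₀ ∧ 0 < R₀ ∧ 0 < κ ∧
      ∀ S : Set (EuclideanSpace ℝ (Fin 3)), (∀ x ∈ S, ∀ z ∈ S, x ≠ z → δ ≤ dist x z) →
        IsMuGSC lennardJones eStar S →
        ∀ L : ℝ, L₀ ≤ L → ∀ a : Fin 3 → ℝ, ∀ C : Finset (EuclideanSpace ℝ (Fin 3)),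
          (↑C : Set (EuclideanSpace ℝ (Fin 3))) =
            S ∩ {z : EuclideanSpace ℝ (Fin 3) | ∀ i, a i ≤ z i ∧ z i < a i + L} →
        ∀ G : Finset (EuclideanSpace ℝ (Fin 3)), G ⊆ C →
          (∀ y ∈ G, ¬ GoodShell ((Measure.count : Measure (EuclideanSpace ℝ (Fin 3))).restrict
              ((fun z => z - y) '' S)) ∧ S ∩ Metric.closedBall y R₀ ⊆ ↑C) →
          t * (C.card : ℝ) ≤ (G.card : ℝ) →
          (C.card : ℝ) * (eStar + κ) ≤ (∑ x ∈ C, ∑ z ∈ C, lennardJones (dist x z)) / 2 := by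
  intro δ hδ t ht
  obtain ⟨R₀, c, hR₀, hc, h⟩ := hPrice δ hδ
  refine ⟨1, R₀, c * t, one_pos, hR₀, mul_pos hc ht, fun S hsep hgsc L _ a C hC G hGC hG hthr => ?_⟩
  have hCS : (↑C : Set (EuclideanSpace ℝ (Fin 3))) ⊆ S := hC ▸ Set.inter_subset_left
  have key := h S hsep hgsc C hCS G hGC hG
  have hct : c * (t * (C.card : ℝ)) ≤ c * (G.card : ℝ) := mul_le_mul_of_nonneg_left hthr hc.le
  nlinarith

/-- **Composition r4 (kept as a sorry-free conditional).**  The threshold transfer applied to the slack event transfer and a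
threshold pricing S7″ (here the HYPOTHESIS `hPrice`) concludes the crux BY NAME. -/
theorem MinimiserShells_of'''
    (hPrice : ∀ δ : ℝ, 0 < δ → ∀ t : ℝ, 0 < t → ∃ L₀ R₀ κ : ℝ, 0 < L₀ ∧ 0 < R₀ ∧ 0 < κ ∧
      ∀ S : Set (EuclideanSpace ℝ (Fin 3)), (∀ x ∈ S, ∀ z ∈ S, x ≠ z → δ ≤ dist x z) →
        IsMuGSC lennardJones eStar S →
        ∀ L : ℝ, L₀ ≤ L → ∀ a : Fin 3 → ℝ, ∀ C : Finset (EuclideanSpace ℝ (Fin 3)),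
          (↑C : Set (EuclideanSpace ℝ (Fin 3))) =
            S ∩ {z : EuclideanSpace ℝ (Fin 3) | ∀ i, a i ≤ z i ∧ z i < a i + L} →
        ∀ G : Finset (EuclideanSpace ℝ (Fin 3)), G ⊆ C →
          (∀ y ∈ G, ¬ GoodShell ((Measure.count : Measure (EuclideanSpace ℝ (Fin 3))).restrict
              ((fun z => z - y) '' S)) ∧ S ∩ Metric.closedBall y R₀ ⊆ ↑C) →
          t * (C.card : ℝ) ≤ (G.card : ℝ) →
          (C.card : ℝ) * (eStar + κ) ≤ (∑ x ∈ C, ∑ z ∈ C, lennardJones (dist x z)) / 2)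
    (hSlack : ∀ δ : ℝ, 0 < δ → ∀ P : Measure (Measure (EuclideanSpace ℝ (Fin 3))), IsProbabilityMeasure P →
      (∀ᵐ μ ∂P, IsRootedHardCore δ μ) → IsPointStationaryLaw P → meanRootEnergy P ≤ eStar →
      ∀ K : Set (EuclideanSpace ℝ (Fin 3)) → Prop,
      (∀ᵐ μ ∂P, ∃ S : Set (EuclideanSpace ℝ (Fin 3)),
        μ = (Measure.count : Measure (EuclideanSpace ℝ (Fin 3))).restrict S ∧ K S) →
      ∀ Ev : Set (Measure (EuclideanSpace ℝ (Fin 3))), MeasurableSet Ev →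
      ∀ L₀ R₀ c s : ℝ, 0 < L₀ → 0 < R₀ → 0 < c → 0 ≤ s →
      (∀ S : Set (EuclideanSpace ℝ (Fin 3)), (∀ x ∈ S, ∀ z ∈ S, x ≠ z → δ ≤ dist x z) → K S →
        ∀ L : ℝ, L₀ ≤ L → ∀ a : Fin 3 → ℝ, ∀ C : Finset (EuclideanSpace ℝ (Fin 3)),
        (↑C : Set (EuclideanSpace ℝ (Fin 3))) = S ∩ {z : EuclideanSpace ℝ (Fin 3) | ∀ i, a i ≤ z i ∧ z i < a i + L} →
        ∀ G : Finset (EuclideanSpace ℝ (Fin 3)), G ⊆ C →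
          (∀ y ∈ G, (Measure.count : Measure (EuclideanSpace ℝ (Fin 3))).restrict ((fun z => z - y) '' S) ∈ Ev ∧
            S ∩ Metric.closedBall y R₀ ⊆ ↑C) →
          (C.card : ℝ) * eStar + c * G.card ≤ (∑ x ∈ C, ∑ z ∈ C, lennardJones (dist x z)) / 2 + s * C.card) →
      P Ev ≤ ENNReal.ofReal (s / c))
    (hTransfer : (∀ δ : ℝ, 0 < δ → ∀ P : Measure (Measure (EuclideanSpace ℝ (Fin 3))), IsProbabilityMeasure P →
      (∀ᵐ μ ∂P, IsRootedHardCore δ μ) → IsPointStationaryLaw P → meanRootEnergy P ≤ eStar →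
      ∀ K : Set (EuclideanSpace ℝ (Fin 3)) → Prop,
      (∀ᵐ μ ∂P, ∃ S : Set (EuclideanSpace ℝ (Fin 3)),
        μ = (Measure.count : Measure (EuclideanSpace ℝ (Fin 3))).restrict S ∧ K S) →
      ∀ Ev : Set (Measure (EuclideanSpace ℝ (Fin 3))), MeasurableSet Ev →
      ∀ L₀ R₀ c s : ℝ, 0 < L₀ → 0 < R₀ → 0 < c → 0 ≤ s →
      (∀ S : Set (EuclideanSpace ℝ (Fin 3)), (∀ x ∈ S, ∀ z ∈ S, x ≠ z → δ ≤ dist x z) → K S →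
        ∀ L : ℝ, L₀ ≤ L → ∀ a : Fin 3 → ℝ, ∀ C : Finset (EuclideanSpace ℝ (Fin 3)),
        (↑C : Set (EuclideanSpace ℝ (Fin 3))) = S ∩ {z : EuclideanSpace ℝ (Fin 3) | ∀ i, a i ≤ z i ∧ z i < a i + L} →
        ∀ G : Finset (EuclideanSpace ℝ (Fin 3)), G ⊆ C →
          (∀ y ∈ G, (Measure.count : Measure (EuclideanSpace ℝ (Fin 3))).restrict ((fun z => z - y) '' S) ∈ Ev ∧
            S ∩ Metric.closedBall y R₀ ⊆ ↑C) →
          (C.card : ℝ) * eStar + c * G.card ≤ (∑ x ∈ C, ∑ z ∈ C, lennardJones (dist x z)) / 2 + s * C.card) →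
      P Ev ≤ ENNReal.ofReal (s / c)) →
      (∀ δ : ℝ, 0 < δ → ∀ t : ℝ, 0 < t → ∃ L₀ R₀ κ : ℝ, 0 < L₀ ∧ 0 < R₀ ∧ 0 < κ ∧
      ∀ S : Set (EuclideanSpace ℝ (Fin 3)), (∀ x ∈ S, ∀ z ∈ S, x ≠ z → δ ≤ dist x z) →
        IsMuGSC lennardJones eStar S →
        ∀ L : ℝ, L₀ ≤ L → ∀ a : Fin 3 → ℝ, ∀ C : Finset (EuclideanSpace ℝ (Fin 3)),
          (↑C : Set (EuclideanSpace ℝ (Fin 3))) =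
            S ∩ {z : EuclideanSpace ℝ (Fin 3) | ∀ i, a i ≤ z i ∧ z i < a i + L} →
        ∀ G : Finset (EuclideanSpace ℝ (Fin 3)), G ⊆ C →
          (∀ y ∈ G, ¬ GoodShell ((Measure.count : Measure (EuclideanSpace ℝ (Fin 3))).restrict
              ((fun z => z - y) '' S)) ∧ S ∩ Metric.closedBall y R₀ ⊆ ↑C) →
          t * (C.card : ℝ) ≤ (G.card : ℝ) →
          (C.card : ℝ) * (eStar + κ) ≤ (∑ x ∈ C, ∑ z ∈ C, lennardJones (dist x z)) / 2) →
      MinimiserShells) :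
    MinimiserShells :=
  hTransfer hSlack hPrice

/-- **The qualitative finite-`N` sufficient condition** (r4): the qualitative shell gap with boundary allowance —
for every `t > 0` some `κ > 0`, `C₀` with `N·(e* + κ) − C₀·N^{2/3} ≤ 𝓔_N(y)` whenever `y` has at least `t·N`
badly-shelled sites; equivalently, `𝓔_N(y_N)/N → e*` forces `#bad(y_N)/N → 0` — implies the crux, through
S12 → S11 → S8b(S8a). -/
theorem minimiserShells_of_qualShellGapWith
    (hGap : ∀ t : ℝ, 0 < t → ∃ κ C₀ : ℝ, 0 < κ ∧ ∀ (N : ℕ) (y : Fin N → EuclideanSpace ℝ (Fin 3)),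
      Function.Injective y →
      t * (N : ℝ) ≤ (Nat.card {i : Fin N // ¬ GoodShell
          ((Measure.count : Measure (EuclideanSpace ℝ (Fin 3))).restrict ((fun z => z - y i) '' Set.range y))} : ℝ) →
      (N : ℝ) * (eStar + κ) - C₀ * (N : ℝ) ^ (2 / 3 : ℝ) ≤ interactionEnergy lennardJones y) :
    MinimiserShells :=
  stub_thresholdTransfer stub_slackEventTransfer
    (stub_thresholdBadPricing_of_qualShellNoBoundary (stub_qualShellNoBoundary_of_qualShellGapWith hGap))

/-- **Composition r3 (kept; its stubs S8–S10 are landed).**  The linear transfer applied to a linear pricing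
concludes the crux BY NAME. -/
theorem MinimiserShells_of''
    (hPrice : ∀ δ : ℝ, 0 < δ → ∃ R₀ c : ℝ, 0 < R₀ ∧ 0 < c ∧
      ∀ S : Set (EuclideanSpace ℝ (Fin 3)), (∀ x ∈ S, ∀ z ∈ S, x ≠ z → δ ≤ dist x z) →
        IsMuGSC lennardJones eStar S →
        ∀ C : Finset (EuclideanSpace ℝ (Fin 3)), (↑C : Set (EuclideanSpace ℝ (Fin 3))) ⊆ S →
        ∀ G : Finset (EuclideanSpace ℝ (Fin 3)), G ⊆ C →
          (∀ y ∈ G, ¬ GoodShell ((Measure.count : Measure (EuclideanSpace ℝ (Fin 3))).restrict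
              ((fun z => z - y) '' S)) ∧ S ∩ Metric.closedBall y R₀ ⊆ ↑C) →
          (C.card : ℝ) * eStar + c * G.card ≤ (∑ x ∈ C, ∑ z ∈ C, lennardJones (dist x z)) / 2)
    (hTransfer : (∀ δ : ℝ, 0 < δ → ∃ R₀ c : ℝ, 0 < R₀ ∧ 0 < c ∧
      ∀ S : Set (EuclideanSpace ℝ (Fin 3)), (∀ x ∈ S, ∀ z ∈ S, x ≠ z → δ ≤ dist x z) →
        IsMuGSC lennardJones eStar S →
        ∀ C : Finset (EuclideanSpace ℝ (Fin 3)), (↑C : Set (EuclideanSpace ℝ (Fin 3))) ⊆ S →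
        ∀ G : Finset (EuclideanSpace ℝ (Fin 3)), G ⊆ C →
          (∀ y ∈ G, ¬ GoodShell ((Measure.count : Measure (EuclideanSpace ℝ (Fin 3))).restrict
              ((fun z => z - y) '' S)) ∧ S ∩ Metric.closedBall y R₀ ⊆ ↑C) →
          (C.card : ℝ) * eStar + c * G.card ≤ (∑ x ∈ C, ∑ z ∈ C, lennardJones (dist x z)) / 2) →
      MinimiserShells) :
    MinimiserShells :=
  hTransfer hPrice

/-- **r3's linear pricing S7′ implies the crux through r4 as well** (S7′ ⇒ S7″ ⇒ crux), so r3 is a special case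
of r4 and nothing landed in r3 is orphaned. -/
theorem minimiserShells_of_deepBadPricing
    (hPrice : ∀ δ : ℝ, 0 < δ → ∃ R₀ c : ℝ, 0 < R₀ ∧ 0 < c ∧
      ∀ S : Set (EuclideanSpace ℝ (Fin 3)), (∀ x ∈ S, ∀ z ∈ S, x ≠ z → δ ≤ dist x z) →
        IsMuGSC lennardJones eStar S →
        ∀ C : Finset (EuclideanSpace ℝ (Fin 3)), (↑C : Set (EuclideanSpace ℝ (Fin 3))) ⊆ S →
        ∀ G : Finset (EuclideanSpace ℝ (Fin 3)), G ⊆ C →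
          (∀ y ∈ G, ¬ GoodShell ((Measure.count : Measure (EuclideanSpace ℝ (Fin 3))).restrict
              ((fun z => z - y) '' S)) ∧ S ∩ Metric.closedBall y R₀ ⊆ ↑C) →
          (C.card : ℝ) * eStar + c * G.card ≤ (∑ x ∈ C, ∑ z ∈ C, lennardJones (dist x z)) / 2) :
    MinimiserShells :=
  stub_thresholdTransfer stub_slackEventTransfer (thresholdBadPricing_of_deepBadPricing hPrice)

/-- **The finite-`N` sufficient condition**: the shell gap with boundary allowance (the analogue, for the
`(a/100)`-close-packed-shell predicate, of crux `ChargedEnergyGap` stmt-AtomisticToContinuum-14231) implies the crux,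
through S10 → S9 → S8. -/
theorem minimiserShells_of_shellGapWith
    (hGap : ∃ κ C₀ : ℝ, 0 < κ ∧ ∀ (N : ℕ) (y : Fin N → EuclideanSpace ℝ (Fin 3)), Function.Injective y →
      (N : ℝ) * eStar + κ * (Nat.card {i : Fin N // ¬ GoodShell
          ((Measure.count : Measure (EuclideanSpace ℝ (Fin 3))).restrict ((fun z => z - y i) '' Set.range y))} : ℝ) -
        C₀ * (N : ℝ) ^ (2 / 3 : ℝ) ≤ interactionEnergy lennardJones y) :
    MinimiserShells :=
  stub_pricingTransfer (stub_deepBadPricing_of_shellNoBoundary (stub_shellNoBoundary_of_shellGapWith hGap))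

/-! ## r2's route as a CLOSED CONDITIONAL theorem: S3′ (zero bad density in the DLR class) ⇒ crux -/

/-- Counting measures determine their carrier: `count|S = count|T → S = T`. [folklore] -/
theorem eq_of_count_restrict_eq {S T : Set (EuclideanSpace ℝ (Fin 3))}
    (h : (Measure.count : Measure (EuclideanSpace ℝ (Fin 3))).restrict S =
      (Measure.count : Measure (EuclideanSpace ℝ (Fin 3))).restrict T) : S = T := by
  ext y
  rw [← count_restrict_singleton_ne_zero_iff S y, ← count_restrict_singleton_ne_zero_iff T y, h]

/-- **r2's composition, sorry-free** (S1, S2, S5, S6′ landed): if badly-shelled atoms have zero relative density in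
large balls about every atom of every uniformly discrete e*-`μ`GSC (r2's stub S3′, here a HYPOTHESIS), the crux holds. -/
theorem minimiserShells_of_badZeroDensity
    (hZero : ∀ S : Set (EuclideanSpace ℝ (Fin 3)), UniformlyDiscrete S → IsMuGSC lennardJones eStar S → ∀ x ∈ S,
      Filter.Tendsto (fun R : ℝ =>
        ({y ∈ S | dist y x ≤ R ∧ ¬ GoodShell ((Measure.count : Measure (EuclideanSpace ℝ (Fin 3))).restrict
            ((fun z => z - y) '' S))}.ncard : ℝ) / ({y ∈ S | dist y x ≤ R}.ncard : ℝ))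
        Filter.atTop (nhds 0)) :
    MinimiserShells := by
  rw [minimiserShells_iff]
  intro δ hδ P hP hcore hstat hE
  have hdlr := stub_equilibriumInLaw stub_energyFloor δ hδ P hP hcore hstat hE
  refine PalmZeroDensity.stub_palmZeroDensity stub_goodShellMeasurable δ hδ P hP hcore hstat ?_
  filter_upwards [hcore, hdlr] with μ hμ hd
  obtain ⟨S, h0, hsep, rfl⟩ := hμ
  obtain ⟨T, hT, hgsc⟩ := hd
  obtain rfl : S = T := eq_of_count_restrict_eq hT
  exact ⟨S, rfl, hZero S ⟨δ, hδ, hsep⟩ hgsc 0 h0⟩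

end Summit.AtomisticToContinuum.Crystallization.Cruxes.MinimiserShells.EquilibriumInLawSurgery

end
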